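import Literature.MathematicalPhysics.QuantumFieldTheory.Balaban1983to89.Node00.Record13DatumKeyCoPR
import Literature.MathematicalPhysics.QuantumFieldTheory.Balaban1983to89.Node00.Record13CoPH

/-!
# NODE 00 (YM-PLAN Track A) — THE STAGE-13 DATUM ∕ RECORD KEYS OF THE v1.7 `CoPH` EDITION: `IsDatumOfRecord₁₃CCoPH` (+ `.params ∕ .provisos`, `canon₁₃CoPH`,
# `IsRateKey₁₃CoPH`), the regime keys `IsDatumOfRecord₁₃CCoPHOn ∕ IsRecordOfRecord₁₃CCoPHOn ∕ canon₁₃CoPHOn`, the CN keys `IsDatumOfRecord₁₃CCoPHN ∕ IsRecordOfRecord₁₃CCoPHN`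
# at the RE-ISSUED guard of record `unityNondeg₁₃H N F θ := θ.ZhUnity F N ∧ θ.SlotsNondegenerate₁₃ F N` over def-T's HISTORY-INDEXED parameter structure `Stage13HParams`
# (`Node00/Record13CoPH`, FILE 27, FINDING №9 ∕ director-ym №183 H1ʰ), keyed FLAT on `datumOfRecord₁₃CoPH F N θ (h : θ.Provisos₁₃CoPH F N)`; §8: the ONE-WAY history-blind
# doors `…CoPR → …CoPH` along def-T's `Stage13HParams.ofHistoryBlind`

NODE 00 RECORD MODULE (cell `pub-ymgap`, seat `pub-ymgap-node00-def-RR-2` gen 13 = second reader ∕ key + instance side of the RATE-RECORD HOME, director-ym R141 (A);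
dag-lead «datum-KEY twin leaf = RR-2 lineage, one declarer»).  THE `CoPH` TWIN (v1.7 EDITION) of this seat's `Node00/Record13DatumKeyCoPR` (p531309; the v1.6 `CoPR` keys over
`Stage13RParams.Provisos₁₃CoPR` and `datumOfRecord₁₃CoPR`).  THE v1.7 EDITION, SAID ONCE (def-T `LOCATED-9-ZetaHistoryBlind-DESIGN` §4 H1ʰ, KEYMAP v1.7, token map T₇): the residual
𝐓-weight of RECORD 13 is HISTORY-INDEXED — def-T's `structure Stage13HParams F N extends Stage13RParams F N` carries ONE new field `Zh : (p : B12.RunParams) → ℕ → (ℕ → Set (Site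
(F.P p.K) 0)) → (ℕ → Set (Site (F.P p.K) 0)) → TkResidualW F N (FluctV N) p.K` (print's `ζ^{(j)}(Ω^c_{j+1})` of THE TERM reads the term's history `(Ω_i, Λ_i)_i`: [III] p.257, p.267,
(3.23) p.270), the weights of record are `WtOfRecord₁₃H θ p s` PER HISTORY `s` (where v1.6 read the history-blind `θ.Zr p`), the bg-free proviso core is `Stage13HParams.Provisos₁₃CoPH`
(v1.6's `Provisos₁₃CoPR` rows VERBATIM at `θ.toStage13Params` with `zhLaws ∕ zhLocal` for `zrLaws ∕ zrLocal`), the guard is `Stage13HParams.ZhUnity`, and the §2 form, the 𝐑-leaf, the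
Stage-5 residual `Stage13HParams.toStage5₁₃CoPH`, the core, the tower and the datum `datumOfRecord₁₃CoPH` are def-T's FILE 25 family re-generated name for name (`CoPR ↦ CoPH`); every
θ-level object that does not read the residual slot (`gOfRecord₁₃`, `betaOfRecord₁₃`, `EOfRecord₁₃`, `UbgOfRecord₁₃CoP`, `Stage13Params.Admissible ∕ .SlotsNondegenerate₁₃`, the
residual-assignment types `RateAssignment₁₃ ∕ SpineAssignment₁₃` and their lifts, …) is NOT re-issued and is CITED at `θ.toStage13Params` (SITE-RULE, unchanged from v1.6: through
`extends`, `θ.Admissible F N`, `θ.SlotsNondegenerate₁₃ F N`, `θ.γ`, `θ.L`, `θ.toStage13Params` read the ancestor structures).  This module is that token map applied to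
`Node00/Record13DatumKeyCoPR` §1–§7: EVERY declaration of §1–§7 below is the v1.6-keyed declaration with binder `(θ : Stage13RParams F N) ↦ (θ : Stage13HParams F N)` (also inside
the regimes' type `Rg : (F : T4Family) → Stage13HParams F N → Prop` and the canonical readings' value types), `(h : θ.Provisos₁₃CoPR F N) ↦ (h : θ.Provisos₁₃CoPH F N)`,
`datumOfRecord₁₃CoPR ↦ datumOfRecord₁₃CoPH`, `θ.toStage5₁₃CoPR ↦ θ.toStage5₁₃CoPH`, `IsRecordOfRecord₁₃CCoPR… ↦ IsRecordOfRecord₁₃CCoPH…`, `θ.ZrUnity ↦ θ.ZhUnity`,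
`unityNondeg₁₃R ↦ unityNondeg₁₃H` in statement and proof, under the NAME RULE «def-T's token `CoPH` at def-T's position»: `IsDatumOfRecord₁₃CCoPR[On∕N] ↦ IsDatumOfRecord₁₃CCoPH[On∕N]`,
`IsRecordOfRecord₁₃CCoPR(On∕N) ↦ IsRecordOfRecord₁₃CCoPH(On∕N)`, `canon₁₃CoPR[On] ↦ canon₁₃CoPH[On]`, `IsRateKey₁₃CoPR ↦ IsRateKey₁₃CoPH`, the theorem stems likewise
(`isDatumOfRecord₁₃CCoPH_datumOfRecord₁₃CoPH`, `exists_keyed_canon₁₃CoPH_iff`, `keyed_canon₁₃CoPHOn_coherent`, `forall_isRecordOfRecord₁₃CCoPHN_iff`, …; the renamed face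
`IsDatumOfRecord₁₃CCoPRN.zrUnity ↦ IsDatumOfRecord₁₃CCoPHN.zhUnity`; the guard pair `unityNondeg₁₃R ∕ unityNondeg₁₃R_iff ↦ unityNondeg₁₃H ∕ unityNondeg₁₃H_iff`) — the 108 declarations of
§1–§7 of the v1.6 leaf map onto the 108 of §1–§7 ONE FOR ONE, statement AND proof (checked byte for byte against the landed file before filing).  The v1.6 leaf's §8 (the run-blind
doors `…CoP → …CoPR` along `Stage13RParams.ofRunBlind`) is NOT imaged (its image would need an embedding `Stage13Params → Stage13HParams` nobody declares); in its place §8 below files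
the SIX history-blind doors `…CoPR → …CoPH` (NEW), with which the landed v1.5 → v1.6 doors compose.  KEYED FLAT on `datumOfRecord₁₃CoPH`.  APPEND-ONLY: a NEW leaf importing this
seat's `Node00/Record13DatumKeyCoPR` (the v1.6 classes, for §8; transitively the v1.5 ∕ v1.2 key modules and `Node00/Record13DatumKey`'s θ-level assignments by name) and def-T's
`Node00/Record13CoPH`; NOTHING landed is edited — the ‴, ⁗, `SepMixed`, `Co`, `SepCo`, `CoP`, `SepCoP`, `CoPR`, `SepCoPR` key modules stand VERBATIM (keys of the earlier editions;
their landed storeys are settled helper leaves).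

CONSUMED BY NAME from def-T's `Node00/Record13CoPH`: `Stage13HParams`, `Stage13HParams.ZhUnity`, `Stage13HParams.Provisos₁₃CoPH`, `datumOfRecord₁₃CoPH`,
`Stage13HParams.toStage5₁₃CoPH`, the RECORD PREDICATE `IsRecordOfRecord₁₃CCoPH F N D w` := `∃ θ (h : θ.Provisos₁₃CoPH F N), θ.Admissible F N ∧ D = datumOfRecord₁₃CoPH F N θ h ∧
w.C = D.C ∧ (0 < w.γ ∧ w.γ ≤ θ.γ) ∧ w.L = θ.L ∧ ∀ P, w.up P = upOfRecord₅C F N (θ.toStage5₁₃CoPH F N) P` (clause order identical to every earlier edition),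
`exists_world_isRecordOfRecord₁₃CCoPH`, `exists_provisos_of_isRecordOfRecord₁₃CCoPH`, `exists_isRecordOfRecord₅C_of_isRecordOfRecord₁₃CCoPH`, the `rfl` ∕ read-off faces `βfun_ ∕
flow_g_ ∕ av_ ∕ isDatumOfRecord₀_datumOfRecord₁₃CoPH`, `isPrintedAveraged_datumOfRecord₁₃CoPH`, and — for §8 only — the HISTORY-BLIND EMBEDDING `Stage13HParams.ofHistoryBlind θ :=
⟨θ, fun p _ _ _ => θ.Zr p⟩` with `Stage13RParams.Provisos₁₃CoPR.ofHistoryBlind`, `Stage13RParams.ZrUnity.ofHistoryBlind`, `datumOfRecord₁₃CoPH_ofHistoryBlind` and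
`Stage13HParams.toStage5₁₃CoPH_ofHistoryBlind` (admissibility ∕ slot non-degeneracy read `toStage13Params` and pass definitionally).  The key layer is PROVISO-FIELD-BLIND,
BACKGROUND-BLIND and RESIDUAL-SLOT-BLIND (no declaration here projects a field of `Provisos₁₃CoPH`, reads `UbgOfRecord₁₃CoP` or reads `θ.Zh`; in particular it is blind to HOW a
consumer reads the history — def-T's DESIGN CALL (β) «prefix by type» lives in the weights, not here), which is why the re-key is a token map and every proof term of §1–§7 is the
v1.6 proof term.

WHY THIS OBJECT (as at v1.1–v1.6; said once more for the v1.7 reader).  The rate-record home and the spine-record home of clusters K4 ∕ K5 are read JOINTLY by the N19′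
edge, so both are keyed to ONE parameter per datum: THE CANONICAL PARAMETER `h.params := Classical.choose h` of `h : IsDatumOfRecord₁₃CCoPH F N D`, with `h.provisos :
h.params.Provisos₁₃CoPH F N`, `h.admissible`, `h.eq_datumOfRecord₁₃CoPH : D = datumOfRecord₁₃CoPH F N h.params h.provisos`; every θ-level object of record then has ONE
datum-level instance per `(F, D, g₀, os)`, keyed records are COHERENT (`exists_keyed_canon₁₃CoPH_iff`, `keyed_canon₁₃CoPH_coherent`), and a consumer proving its node at EVERY
admissible history-indexed tuple with core provisos proves it at the datum (`IsDatumOfRecord₁₃CCoPH.forall_params`).  `isDatumOfRecord₁₃CCoPH_iff_exists_world`: the datum class IS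
def-T's `IsRecordOfRecord₁₃CCoPH` with the world forgotten; «`∃ D w, IsRecordOfRecord₁₃CCoPH F N D w`» REDUCES HONESTLY to «one admissible `Stage13HParams` with every field of
`Provisos₁₃CoPH` a theorem» (`exists_isDatumOfRecord₁₃CCoPH_iff_exists_params`) — INHABITATION IS NOT CLAIMED HERE.  THE REGIME KEYS (§4–§6) and the CN KEYS (§7) read exactly as
at v1.6 with `Rg : (F : T4Family) → Stage13HParams F N → Prop` and the guard `unityNondeg₁₃H N` (literal faces `isDatumOfRecord₁₃CCoPHN_iff`, `exists_isDatumOfRecord₁₃CCoPHN_iff_exists_params`,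
`forall_isRecordOfRecord₁₃CCoPHN_iff` = a CoPH-keyed ∀-storey's binder prefix `∀ (θ : Stage13HParams F N) (hc : θ.Provisos₁₃CoPH F N), (θ.ZhUnity F N ∧ θ.SlotsNondegenerate₁₃ F N) →
θ.Admissible F N → … (datumOfRecord₁₃CoPH F N θ hc) …`).  The route's ITEM texts of the v1.7 revision key on the proviso OF RECORD `Stage13HParams.Provisos₁₃SepCoPH` (the item must
SEE the `bg` row; def-T FILE 28T `Node00/Record13SepCoPH`); the item-facing junction sentences live in this seat's `Node00/Record13DatumKeySepCoPH`, whose §8 bridges the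
`SepCoPH`-keyed classes INTO the classes below along `Provisos₁₃SepCoPH.toCore` (datum by `rfl`), exactly as `…KeySepCoPR` §8 does at v1.6.

§8 — THE HISTORY-BLIND DOORS (NEW; ONE-WAY).  Along def-T's embedding `Stage13HParams.ofHistoryBlind` every v1.6 `CoPR`-keyed fact IS a v1.7 `CoPH`-keyed fact AT THE SAME DATUM AND
WORLD: `IsDatumOfRecord₁₃CCoPH.ofCoPR : IsDatumOfRecord₁₃CCoPR F N D → IsDatumOfRecord₁₃CCoPH F N D`, `IsRateKey₁₃CoPH.ofCoPR : IsRateKey₁₃CoPR F N D w θ → IsRateKey₁₃CoPH F N D w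
(Stage13HParams.ofHistoryBlind F N θ)`, the regime forms `IsDatumOfRecord₁₃CCoPHOn.ofCoPR ∕ IsRecordOfRecord₁₃CCoPHOn.ofCoPR` (given a regime transport `∀ F θ, Rg F θ → RgH F
(Stage13HParams.ofHistoryBlind F N θ)`), and the CN instances `IsDatumOfRecord₁₃CCoPHN.ofCoPR ∕ IsRecordOfRecord₁₃CCoPHN.ofCoPR` (the guard transported by
`Stage13RParams.ZrUnity.ofHistoryBlind`, slot non-degeneracy definitionally) — the datum-level half of «K0 of the v1.7 revision ⇐ K0 of v1.6» (def-T's record-level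
`IsRecordOfRecord₁₃CCoPH.ofCoPR` is the other half).  NO CONVERSE exists or is claimed: a history-indexed residual is in general NOT constant along the histories of one run (that is
FINDING №9), so nothing `CoPH → CoPR` is filed; the landed v1.5 → v1.6 run-blind doors (`Node00/Record13DatumKeyCoPR` §8) compose with §8 to give v1.5 → v1.7 and are not re-issued;
and, as at every edition, NO bridge from or to the ‴ ∕ ⁗ ∕ `SepMixed` ∕ `Co` ∕ `SepCo` keys is statable (different data of record).

WHAT IS NOT HERE.  NO edit of any landed key module or consumer; NO `CoPH → CoPR`, NO `CoPH → SepCoPH` bridge; NO `₁₂ ↔ ₁₃` key bridge; NO reading of any proviso row, of the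
background or of the residual slots `Zr ∕ Zh`; NO inhabitant of any key; the θ-level assignments are NOT re-declared (imported by name and cited at `θ.toStage13Params` by the
consumers); def-T's history-indexed record predicate and its faces are NOT re-declared (consumed by name from `Node00/Record13CoPH`); NO `Provisos₁₃CoPH` inhabitant and NO record
is claimed to exist.

HONEST FRAMING.  Definitions of record + kernel bookkeeping (`Classical.choose`, `rfl`, `dite`, ∃-repackaging) — a typing-faithfulness re-key (FINDING №9) of a CONDITIONAL
finite-𝕋⁴ record at fixed `ε`; NOTHING of Bałaban's is asserted; NO inhabitant of any key is claimed (the record's inhabitation item is OPEN); no node is discharged; counts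
unmoved (COUNT-NEUTRAL); one finite four-torus programme at fixed `ε` — NOT the continuum limit on ℝ⁴, NOT infinite volume, NOT OS, NOT a mass gap, NOT the Clay problem.
No `sorry` ∕ `axiom` ∕ `opaque` ∕ `instance` ∕ `notation`.  [Balaban1989LargeFieldII] = Commun. Math. Phys. **122** (1989) 355–392; [III] = [Balaban1988Convergent] = Commun.
Math. Phys. **119** (1988) 243–285 (p.257 L31–34, p.267, (3.23) p.270: the residual reads the term's history; (3.16)–(3.22) pp.268–269: the partition of unity);
[Balaban1988RG2Cluster] = Commun. Math. Phys. **116** (1988) 1–22; [Balaban1987RG1] = Commun. Math. Phys. **109** (1987) 249–301; [15] = [Balaban1985Variational] = Commun. Math.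
Phys. **102** (1985) 277–309 and [6] = [Balaban1985RegularSpaces] = Commun. Math. Phys. **99** (1985) 75–102 cited for orientation only, nothing of them asserted.
-/

noncomputable section

namespace Literature.MathematicalPhysics.QuantumFieldTheory.Balaban1983to89.Node00

open T4Continuum AveragingRT T4FiniteEpsInhabited FlowStep FlowStepRuns DagBinding T4DatumAssembly

/-! ## §1. «`D` is a datum of record, Stage 13» and its CANONICAL parameter -/

section DatumKey

variable (F : T4Family) (N : ℕ) [NeZero N]

/-- **«`D` is a datum of record, Stage 13 (C-class)»**: SOME admissible Stage-13 parameter tuple satisfying its displayed provisos has `D` as its datum of record — the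
datum-level shadow of `IsRecordOfRecord₁₃CCoPH` (the world forgotten; `isDatumOfRecord₁₃CCoPH_iff_exists_world`). [cite: Balaban1989LargeFieldII, Thm 1 + (0.1) pp.355–356; Balaban1988Convergent, Thms 1–2 pp.262–263 (objects of record; bookkeeping)] -/
def IsDatumOfRecord₁₃CCoPH (D : FiniteEpsData F (SU N)) : Prop :=
  ∃ (θ : Stage13HParams F N) (h : θ.Provisos₁₃CoPH F N), θ.Admissible F N ∧ D = datumOfRecord₁₃CoPH F N θ h

/-- Every admissible Stage-13 parameter tuple with provisos yields a datum of record. [cite: Balaban1989LargeFieldII, Thm 1 + (0.1) pp.355–356 (bookkeeping)] -/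
theorem isDatumOfRecord₁₃CCoPH_datumOfRecord₁₃CoPH (θ : Stage13HParams F N) (h : θ.Provisos₁₃CoPH F N) (hθ : θ.Admissible F N) :
    IsDatumOfRecord₁₃CCoPH F N (datumOfRecord₁₃CoPH F N θ h) :=
  ⟨θ, h, hθ, rfl⟩

/-- **K0′ READS THE SAME AT THE DATUM**: some datum of record exists at `(F, N)` iff some Stage-13 record pair `(D, w)` exists (the body of the route's K0′
`Record12Inhabited` at `N`). [cite: Balaban1989LargeFieldII, Thm 1 + (0.1) pp.355–356 (bookkeeping)] -/
theorem exists_isDatumOfRecord₁₃CCoPH_iff_exists_record :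
    (∃ D : FiniteEpsData F (SU N), IsDatumOfRecord₁₃CCoPH F N D) ↔ ∃ (D : FiniteEpsData F (SU N)) (w : WorldP), IsRecordOfRecord₁₃CCoPH F N D w := by
  constructor
  · rintro ⟨_, θ, hP, hθ, rfl⟩
    obtain ⟨w, hw, -⟩ := exists_world_isRecordOfRecord₁₃CCoPH F N θ hP hθ ⟨hθ.toStage9.gamma_pos, le_rfl⟩
    exact ⟨_, w, hw⟩
  · rintro ⟨D, w, hw⟩
    exact ⟨D, exists_provisos_of_isRecordOfRecord₁₃CCoPH hw⟩

/-- **THE HONEST REDUCTION OF K0′**: some datum of record exists at `(F, N)` iff SOME Stage-13 parameter tuple is admissible and satisfies every displayed proviso —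
«exhibit ONE admissible `Stage13HParams` with EVERY proviso field a theorem» (the K0′ components); inhabitation is NOT claimed in this module.
[cite: Balaban1988Convergent, (2.7) p.255, (2.21) p.258, (2.28) p.259, (3.16) p.268, (3.21) p.269; Balaban1987RG1, (1.12)–(1.15) p.262 (hypothesis dictionary; bookkeeping)] -/
theorem exists_isDatumOfRecord₁₃CCoPH_iff_exists_params :
    (∃ D : FiniteEpsData F (SU N), IsDatumOfRecord₁₃CCoPH F N D) ↔ ∃ θ : Stage13HParams F N, θ.Provisos₁₃CoPH F N ∧ θ.Admissible F N := by
  constructor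
  · rintro ⟨_, θ, hP, hθ, -⟩
    exact ⟨θ, hP, hθ⟩
  · rintro ⟨θ, hP, hθ⟩
    exact ⟨_, isDatumOfRecord₁₃CCoPH_datumOfRecord₁₃CoPH F N θ hP hθ⟩

variable {F N}
variable {D : FiniteEpsData F (SU N)} {w : WorldP}

/-- A Stage-13 record's datum is a Stage-13 datum of record. [cite: Balaban1989LargeFieldII, Thm 1 p.355 (bookkeeping)] -/
theorem isDatumOfRecord₁₃CCoPH_of_isRecordOfRecord₁₃CCoPH (h : IsRecordOfRecord₁₃CCoPH F N D w) : IsDatumOfRecord₁₃CCoPH F N D :=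
  exists_provisos_of_isRecordOfRecord₁₃CCoPH h

/-- **DATUM OF RECORD ⟺ RECORD AT SOME WORLD.** [cite: Balaban1989LargeFieldII, Thm 1 + (0.1) pp.355–356 (bookkeeping)] -/
theorem isDatumOfRecord₁₃CCoPH_iff_exists_world : IsDatumOfRecord₁₃CCoPH F N D ↔ ∃ w : WorldP, IsRecordOfRecord₁₃CCoPH F N D w := by
  constructor
  · rintro ⟨θ, hP, hθ, rfl⟩
    obtain ⟨w, hw, -⟩ := exists_world_isRecordOfRecord₁₃CCoPH F N θ hP hθ ⟨hθ.toStage9.gamma_pos, le_rfl⟩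
    exact ⟨w, hw⟩
  · rintro ⟨w, hw⟩
    exact isDatumOfRecord₁₃CCoPH_of_isRecordOfRecord₁₃CCoPH hw

/-- **THE CANONICAL STAGE-13 PARAMETER OF A DATUM OF RECORD** (choice) — the ONE key both carrier records of clusters K4 ∕ K5 are read at.
[cite: Balaban1989LargeFieldII, Thm 1 + (0.1) pp.355–356 (bookkeeping)] -/
def IsDatumOfRecord₁₃CCoPH.params (h : IsDatumOfRecord₁₃CCoPH F N D) : Stage13HParams F N :=
  Classical.choose h

/-- Its provisos. [cite: Balaban1988Convergent, (2.7) p.255, (2.21) p.258, (2.35) p.261 (bookkeeping)] -/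
theorem IsDatumOfRecord₁₃CCoPH.provisos (h : IsDatumOfRecord₁₃CCoPH F N D) : h.params.Provisos₁₃CoPH F N :=
  (Classical.choose_spec h).fst

/-- Its admissibility. [cite: Balaban1987RG1, (1.12) p.262; Balaban1988Convergent, (2.10) p.256 (bookkeeping)] -/
theorem IsDatumOfRecord₁₃CCoPH.admissible (h : IsDatumOfRecord₁₃CCoPH F N D) : h.params.Admissible F N :=
  (Classical.choose_spec h).snd.1

/-- **The datum IS the datum of record of its canonical parameter.** [cite: Balaban1989LargeFieldII, Thm 1 p.355 (bookkeeping)] -/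
theorem IsDatumOfRecord₁₃CCoPH.eq_datumOfRecord₁₃CoPH (h : IsDatumOfRecord₁₃CCoPH F N D) : D = datumOfRecord₁₃CoPH F N h.params h.provisos :=
  (Classical.choose_spec h).snd.2

/-- The canonical parameter's coupling window is positive. [cite: Balaban1987RG1, (0.21) p.256 (bookkeeping)] -/
theorem IsDatumOfRecord₁₃CCoPH.gamma_pos (h : IsDatumOfRecord₁₃CCoPH F N D) : 0 < h.params.γ :=
  h.admissible.toStage9.gamma_pos

/-- … and lies inside `]0, 1[` (the Stage-12 sign `γ < 1` of the tuple's Stage-12 admissibility). [cite: Balaban1988Convergent, (2.28) p.259 (bookkeeping)] -/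
theorem IsDatumOfRecord₁₃CCoPH.gamma_lt_one (h : IsDatumOfRecord₁₃CCoPH F N D) : h.params.γ < 1 :=
  h.admissible.toStage12.pos₁₂.2.2.2.2

/-- **WHAT A CONSUMER PROVES ⟹ WHAT THE INSTANCE CARRIES**: a property of the objects of record established at EVERY admissible Stage-13 parameter tuple with provisos
holds at the canonical parameter of every datum of record. [cite: Balaban1989LargeFieldII, Thm 1 p.355 (bookkeeping)] -/
theorem IsDatumOfRecord₁₃CCoPH.forall_params {P : (D : FiniteEpsData F (SU N)) → (θ : Stage13HParams F N) → θ.Provisos₁₃CoPH F N → Prop}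
    (hP : ∀ (θ : Stage13HParams F N) (hθ : θ.Provisos₁₃CoPH F N), θ.Admissible F N → P (datumOfRecord₁₃CoPH F N θ hθ) θ hθ) (h : IsDatumOfRecord₁₃CCoPH F N D) :
    P D h.params h.provisos := by
  have := hP h.params h.provisos h.admissible
  rwa [← h.eq_datumOfRecord₁₃CoPH] at this

/-- **WORLD COMPANION IN `₁₃C` AT ANY WINDOW BELOW THE CANONICAL ONE**: for `0 < γw ≤ h.params.γ` some world makes `(D, w)` a Stage-13 record with `w.γ = γw` — what
the N17 home-keying binder («`RRec … R → ∃ w, IsRecordOfRecord₁₃CCoPH F N D w ∧ R.u3.γ = w.γ`») consumes once `R.u3.γ` is pinned in that range.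
[cite: Balaban1989LargeFieldII, Thm 1 + (0.1) pp.355–356 (bookkeeping)] -/
theorem IsDatumOfRecord₁₃CCoPH.exists_world (h : IsDatumOfRecord₁₃CCoPH F N D) {γw : ℝ} (hγw : 0 < γw ∧ γw ≤ h.params.γ) :
    ∃ w : WorldP, IsRecordOfRecord₁₃CCoPH F N D w ∧ w.γ = γw := by
  obtain ⟨w, hw, hγ⟩ := exists_world_isRecordOfRecord₁₃CCoPH F N h.params h.provisos h.admissible hγw
  exact ⟨w, h.eq_datumOfRecord₁₃CoPH ▸ hw, hγ⟩

/-- … in particular at the canonical window `h.params.γ` itself. [cite: Balaban1989LargeFieldII, Thm 1 + (0.1) pp.355–356 (bookkeeping)] -/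
theorem IsDatumOfRecord₁₃CCoPH.exists_world_gamma (h : IsDatumOfRecord₁₃CCoPH F N D) :
    ∃ w : WorldP, IsRecordOfRecord₁₃CCoPH F N D w ∧ w.γ = h.params.γ :=
  h.exists_world ⟨h.gamma_pos, le_rfl⟩

/-- **THE DATUM's β-FUNCTIONS ARE THE STAGE-13 β OF RECORD AT THE CANONICAL PARAMETER** (def-T's `βfun_datumOfRecord₁₃CoPH`, `rfl` there; `betaOfRecord₁₃ F N θ` over
`Stage13HParams` is def-T's reducible name for the β of record re-based on the canonical-version transport and the (2.9)-species small-field function — NOT `betaOfRecord₁₀` of Stages 10–12: the histories of record differ, and there is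
NO ₁₂ ↔ ₁₃ key bridge in this module) — what the (D4) read-out binders and node N17 read off `D`.
[cite: Balaban1987RG1, (1.20)–(1.22) p.264 (bookkeeping)] -/
theorem IsDatumOfRecord₁₃CCoPH.βfun_eq_betaOfRecord₁₃ (h : IsDatumOfRecord₁₃CCoPH F N D) : D.βfun = betaOfRecord₁₃ F N h.params.toStage13Params := by
  have := βfun_datumOfRecord₁₃CoPH F N h.params h.provisos
  rwa [← h.eq_datumOfRecord₁₃CoPH] at this

/-- The datum's coupling flow of the run `p` IS the Stage-13 generated history of record of the canonical parameter (def-T's `flow_g_datumOfRecord₁₃CoPH`).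
[cite: Balaban1987RG1, (0.17)–(0.20) pp.255–256 (bookkeeping)] -/
theorem IsDatumOfRecord₁₃CCoPH.flow_g (h : IsDatumOfRecord₁₃CCoPH F N D) (p : B12.RunParams) :
    (D.C p).flow.g = gOfRecord₁₃ F N h.params.toStage13Params p := by
  have := flow_g_datumOfRecord₁₃CoPH F N h.params h.provisos p
  rwa [← h.eq_datumOfRecord₁₃CoPH] at this

/-- The datum's averaging maps ARE the averaging maps of record. [cite: Balaban1987RG1, (0.4) p.253 (bookkeeping)] -/
theorem IsDatumOfRecord₁₃CCoPH.av_eq (h : IsDatumOfRecord₁₃CCoPH F N D) : D.av = avOfRecord F N := by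
  have := av_datumOfRecord₁₃CoPH F N h.params h.provisos
  rwa [← h.eq_datumOfRecord₁₃CoPH] at this

/-- A Stage-13 datum of record is a datum of record, Stage 0 (binder B1 ∕ node N23's reading). [cite: Balaban1987RG1, (0.3)–(0.4) p.253 (bookkeeping)] -/
theorem IsDatumOfRecord₁₃CCoPH.isDatumOfRecord₀ (h : IsDatumOfRecord₁₃CCoPH F N D) : IsDatumOfRecord₀ F N D := by
  rw [h.eq_datumOfRecord₁₃CoPH]
  exact isDatumOfRecord₀_datumOfRecord₁₃CoPH F N h.params h.provisos

/-- N23 · binder B1 at every Stage-13 datum of record. [cite: Balaban1987RG1, (0.4) p.253] -/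
theorem IsDatumOfRecord₁₃CCoPH.isPrintedAveraged (h : IsDatumOfRecord₁₃CCoPH F N D) : D.IsPrintedAveraged := by
  rw [h.eq_datumOfRecord₁₃CoPH]
  exact isPrintedAveraged_datumOfRecord₁₃CoPH F N h.params h.provisos

/-- **THE ₅C SHADOW AT THE CANONICAL PARAMETER**: a Stage-13 datum of record is refined by a Stage-5 C-bound record at some world (def-T's
`exists_isRecordOfRecord₅C_of_isRecordOfRecord₁₃CCoPH` through the world companion) — for consumers keyed at ₅C. [cite: Balaban1989LargeFieldII, Thm 1 + (0.1) pp.355–356 (bookkeeping)] -/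
theorem IsDatumOfRecord₁₃CCoPH.exists_isRecordOfRecord₅C (h : IsDatumOfRecord₁₃CCoPH F N D) :
    ∃ (D₅ : FiniteEpsData F (SU N)) (w : WorldP), IsRecordOfRecord₅C F N D₅ w ∧ D₅.C = D.C ∧ (∀ K g₀ k, D₅.dens K g₀ k = D.dens K g₀ k) ∧
      D₅.βfun = D.βfun ∧ D₅.av = D.av := by
  obtain ⟨w, hw, -⟩ := h.exists_world_gamma
  obtain ⟨D₅, h₅⟩ := exists_isRecordOfRecord₅C_of_isRecordOfRecord₁₃CCoPH hw
  exact ⟨D₅, w, h₅⟩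

end DatumKey

/-! ## §2. Canonicalised readings — COHERENCE for records keyed «`∃ θ hP, θ.Admissible F N ∧ D = datumOfRecord₁₃CoPH F N θ hP ∧ S = cr F θ hP …`»

Reading an existentially keyed record through `canon₁₃CoPH f` makes the admitted bundle a function of the DATUM: `canon₁₃CoPH f θ hP = f h.params h.provisos` whenever
`datumOfRecord₁₃CoPH F N θ hP = D` and `h : IsDatumOfRecord₁₃CCoPH F N D` (`canon₁₃CoPH_eq_of_eq`), so two records keyed independently but read through `canon₁₃CoPH` admit, at the
same `(F, D, g₀, os)`, bundles read at the SAME parameter (`exists_keyed_canon₁₃CoPH_iff` turns either key into «`∃ h : IsDatumOfRecord₁₃CCoPH F N D, Φ (f h.params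
h.provisos)`»).  Off the datum-of-record class `canon₁₃CoPH f = f`. -/
section Canon

variable (F : T4Family) (N : ℕ) [NeZero N] {α : Sort*}

/-- **CANONICALISED READING**: read `f` at the canonical parameter of the datum `datumOfRecord₁₃CoPH F N θ hP` when that datum is of record (admissible), else at
`(θ, hP)` itself.  Kernel bookkeeping (`Classical.dec`, `dite`). [cite: Balaban1989LargeFieldII, Thm 1 + (0.1) pp.355–356 (bookkeeping)] -/
def canon₁₃CoPH (f : (θ : Stage13HParams F N) → θ.Provisos₁₃CoPH F N → α) (θ : Stage13HParams F N) (hP : θ.Provisos₁₃CoPH F N) : α := by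
  classical
  exact if h : IsDatumOfRecord₁₃CCoPH F N (datumOfRecord₁₃CoPH F N θ hP) then f h.params h.provisos else f θ hP

variable {F N}

/-- The canonical parameter depends on the datum only: transport of the key along `D = D'` does not change `.params` (proof irrelevance + `subst`).
[cite: Balaban1989LargeFieldII, Thm 1 + (0.1) pp.355–356 (bookkeeping)] -/
theorem IsDatumOfRecord₁₃CCoPH.params_congr {D D' : FiniteEpsData F (SU N)} (h : IsDatumOfRecord₁₃CCoPH F N D) (h' : IsDatumOfRecord₁₃CCoPH F N D') (e : D = D') :
    h.params = h'.params := by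
  subst e
  rfl

/-- **`canon₁₃CoPH f θ hP = f h.params h.provisos`** whenever `(θ, hP)` realises a datum of record `D` with key `h`. [cite: Balaban1989LargeFieldII, Thm 1 + (0.1) pp.355–356 (bookkeeping)] -/
theorem canon₁₃CoPH_eq_of_eq {f : (θ : Stage13HParams F N) → θ.Provisos₁₃CoPH F N → α} {D : FiniteEpsData F (SU N)} (h : IsDatumOfRecord₁₃CCoPH F N D)
    (θ : Stage13HParams F N) (hP : θ.Provisos₁₃CoPH F N) (e : D = datumOfRecord₁₃CoPH F N θ hP) :
    canon₁₃CoPH F N f θ hP = f h.params h.provisos := by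
  subst e
  unfold canon₁₃CoPH
  rw [dif_pos h]

/-- At the canonical parameter itself `canon₁₃CoPH f` reads `f`. [cite: Balaban1989LargeFieldII, Thm 1 + (0.1) pp.355–356 (bookkeeping)] -/
theorem canon₁₃CoPH_params {f : (θ : Stage13HParams F N) → θ.Provisos₁₃CoPH F N → α} {D : FiniteEpsData F (SU N)} (h : IsDatumOfRecord₁₃CCoPH F N D) :
    canon₁₃CoPH F N f h.params h.provisos = f h.params h.provisos :=
  canon₁₃CoPH_eq_of_eq h h.params h.provisos h.eq_datumOfRecord₁₃CoPH

/-- At an admissible tuple with provisos, `canon₁₃CoPH f` reads `f` at the canonical parameter of ITS datum. [cite: Balaban1989LargeFieldII, Thm 1 + (0.1) pp.355–356 (bookkeeping)] -/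
theorem canon₁₃CoPH_eq_of_admissible {f : (θ : Stage13HParams F N) → θ.Provisos₁₃CoPH F N → α} (θ : Stage13HParams F N) (hP : θ.Provisos₁₃CoPH F N) (hθ : θ.Admissible F N) :
    canon₁₃CoPH F N f θ hP = f (isDatumOfRecord₁₃CCoPH_datumOfRecord₁₃CoPH F N θ hP hθ).params (isDatumOfRecord₁₃CCoPH_datumOfRecord₁₃CoPH F N θ hP hθ).provisos :=
  canon₁₃CoPH_eq_of_eq _ θ hP rfl

/-- Off the datum-of-record class nothing is canonicalised. [cite: Balaban1989LargeFieldII, Thm 1 + (0.1) pp.355–356 (bookkeeping)] -/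
theorem canon₁₃CoPH_eq_self_of_not {f : (θ : Stage13HParams F N) → θ.Provisos₁₃CoPH F N → α} (θ : Stage13HParams F N) (hP : θ.Provisos₁₃CoPH F N)
    (hn : ¬ IsDatumOfRecord₁₃CCoPH F N (datumOfRecord₁₃CoPH F N θ hP)) : canon₁₃CoPH F N f θ hP = f θ hP := by
  unfold canon₁₃CoPH
  rw [dif_neg hn]

/-- **THE KEYED-RECORD FACE**: an existentially keyed record («some admissible `θ` with provisos realises `D` and the bundle reads `canon₁₃CoPH f` there») IS the
datum-keyed record («the bundle reads `f` at the canonical parameter of `D`») — for every property `Φ` of the reading (e.g. `Φ x := S = x g₀ os`).  This is the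
sentence that makes (T-SPINE)'s and (T-RATE)'s Stage-13 records COHERENT. [cite: Balaban1989LargeFieldII, Thm 1 + (0.1) pp.355–356 (bookkeeping)] -/
theorem exists_keyed_canon₁₃CoPH_iff {f : (θ : Stage13HParams F N) → θ.Provisos₁₃CoPH F N → α} {D : FiniteEpsData F (SU N)} (Φ : α → Prop) :
    (∃ (θ : Stage13HParams F N) (hP : θ.Provisos₁₃CoPH F N), θ.Admissible F N ∧ D = datumOfRecord₁₃CoPH F N θ hP ∧ Φ (canon₁₃CoPH F N f θ hP)) ↔
      ∃ h : IsDatumOfRecord₁₃CCoPH F N D, Φ (f h.params h.provisos) := by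
  constructor
  · rintro ⟨θ, hP, hθ, e, hΦ⟩
    have h : IsDatumOfRecord₁₃CCoPH F N D := ⟨θ, hP, hθ, e⟩
    refine ⟨h, ?_⟩
    rwa [canon₁₃CoPH_eq_of_eq (f := f) h θ hP e] at hΦ
  · rintro ⟨h, hΦ⟩
    refine ⟨h.params, h.provisos, h.admissible, h.eq_datumOfRecord₁₃CoPH, ?_⟩
    rwa [canon₁₃CoPH_params (f := f) h]

/-- **COHERENCE**: two existentially keyed records read through `canon₁₃CoPH` admit, at the same datum, readings AT THE SAME PARAMETER.
[cite: Balaban1989LargeFieldII, Thm 1 + (0.1) pp.355–356 (bookkeeping)] -/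
theorem keyed_canon₁₃CoPH_coherent {β : Sort*} {f : (θ : Stage13HParams F N) → θ.Provisos₁₃CoPH F N → α} {g : (θ : Stage13HParams F N) → θ.Provisos₁₃CoPH F N → β}
    {D : FiniteEpsData F (SU N)} (Φ : α → Prop) (Ψ : β → Prop)
    (hΦ : ∃ (θ : Stage13HParams F N) (hP : θ.Provisos₁₃CoPH F N), θ.Admissible F N ∧ D = datumOfRecord₁₃CoPH F N θ hP ∧ Φ (canon₁₃CoPH F N f θ hP))
    (hΨ : ∃ (θ : Stage13HParams F N) (hP : θ.Provisos₁₃CoPH F N), θ.Admissible F N ∧ D = datumOfRecord₁₃CoPH F N θ hP ∧ Ψ (canon₁₃CoPH F N g θ hP)) :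
    ∃ h : IsDatumOfRecord₁₃CCoPH F N D, Φ (f h.params h.provisos) ∧ Ψ (g h.params h.provisos) := by
  obtain ⟨h, h₁⟩ := (exists_keyed_canon₁₃CoPH_iff Φ).1 hΦ
  obtain ⟨h', h₂⟩ := (exists_keyed_canon₁₃CoPH_iff Ψ).1 hΨ
  exact ⟨h, h₁, h₂⟩

end Canon

/-! ## §3. The θ-exposed Stage-13 record key `IsRateKey₁₃CoPH` and the residual ASSIGNMENTS of the rate-record home at Stage 13 (`RateAssignment₁₃` ∕ `SpineAssignment₁₃` over
`Stage13HParams`, with the one-token lifts `.ofStage12` ∕ `.ofStage9` of the Stage-12 ∕ Stage-9-typed assignments; RR-1's object containers BY NAME) -/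

section Key

variable (F : T4Family) (N : ℕ) [NeZero N]

/-- **«(D, w) is the Stage-13 record WITH PARAMETERS θ»**: the body of `IsRecordOfRecord₁₃CCoPH F N D w` with the Stage-13 parameter tuple EXPOSED — θ is admissible and
satisfies its displayed provisos, its datum of record IS `D`, and the world `w` is bound to the construction with a window `0 < w.γ ≤ θ.γ`, Bałaban's block size and
the C-binding of record over the Stage-13 view. [cite: Balaban1989LargeFieldII, Thm 1 + (0.1) pp.355–356; Balaban1987RG1, (0.24)–(0.25) p.257 (objects of record; bookkeeping)] -/
def IsRateKey₁₃CoPH (D : FiniteEpsData F (SU N)) (w : WorldP) (θ : Stage13HParams F N) : Prop :=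
  ∃ h : θ.Provisos₁₃CoPH F N, θ.Admissible F N ∧ D = datumOfRecord₁₃CoPH F N θ h ∧ w.C = D.C ∧ (0 < w.γ ∧ w.γ ≤ θ.γ) ∧
    w.L = (θ.L : ℝ) ∧ ∀ P : B12.RunParams, w.up P = upOfRecord₅C F N (θ.toStage5₁₃CoPH F N) P

/-- **A Stage-13 record IS a keyed record for SOME θ, and conversely** (`Iff.rfl`: the key is `IsRecordOfRecord₁₃CCoPH`'s body). [cite: Balaban1989LargeFieldII, Thm 1 + (0.1) pp.355–356 (bookkeeping)] -/
theorem isRecordOfRecord₁₃CCoPH_iff_exists_isRateKey₁₃CoPH (D : FiniteEpsData F (SU N)) (w : WorldP) :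
    IsRecordOfRecord₁₃CCoPH F N D w ↔ ∃ θ : Stage13HParams F N, IsRateKey₁₃CoPH F N D w θ := Iff.rfl

/-- **Pointed form of the key** at the datum of record. [cite: Balaban1989LargeFieldII, Thm 1 + (0.1) pp.355–356 (bookkeeping)] -/
theorem isRateKey₁₃CoPH_of_eq (θ : Stage13HParams F N) (h : θ.Provisos₁₃CoPH F N) (hθ : θ.Admissible F N) (w : WorldP)
    (hC : w.C = (datumOfRecord₁₃CoPH F N θ h).C) (hγ : 0 < w.γ ∧ w.γ ≤ θ.γ) (hL : w.L = (θ.L : ℝ))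
    (hup : ∀ P, w.up P = upOfRecord₅C F N (θ.toStage5₁₃CoPH F N) P) :
    IsRateKey₁₃CoPH F N (datumOfRecord₁₃CoPH F N θ h) w θ :=
  ⟨h, hθ, rfl, hC, hγ, hL, hup⟩

/-- **Every admissible θ satisfying its provisos is keyed at some world with any window `0 < γw ≤ θ.γ`** — inhabitation of the keyed class is Stage 13's exactly.
[cite: Balaban1989LargeFieldII, Thm 1 + (0.1) pp.355–356 (bookkeeping)] -/
theorem exists_world_isRateKey₁₃CoPH (θ : Stage13HParams F N) (h : θ.Provisos₁₃CoPH F N) (hθ : θ.Admissible F N) {γw : ℝ} (hγw : 0 < γw ∧ γw ≤ θ.γ) :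
    ∃ w : WorldP, IsRateKey₁₃CoPH F N (datumOfRecord₁₃CoPH F N θ h) w θ ∧ w.γ = γw := by
  obtain ⟨w₀⟩ := nonempty_worldP
  exact ⟨{ w₀ with
      C := (datumOfRecord₁₃CoPH F N θ h).C, γ := γw, L := (θ.L : ℝ), one_lt_L := by exact_mod_cast θ.hL.2,
      up := fun P => upOfRecord₅C F N (θ.toStage5₁₃CoPH F N) P },
    ⟨h, hθ, rfl, rfl, hγw, rfl, fun _ => rfl⟩, rfl⟩

variable {F N}
variable {D : FiniteEpsData F (SU N)} {w : WorldP} {θ : Stage13HParams F N}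

/-- A keyed record is a Stage-13 record. [cite: Balaban1989LargeFieldII, Thm 1 + (0.1) pp.355–356 (bookkeeping)] -/
theorem IsRateKey₁₃CoPH.isRecordOfRecord₁₃CCoPH (hk : IsRateKey₁₃CoPH F N D w θ) : IsRecordOfRecord₁₃CCoPH F N D w := ⟨θ, hk⟩

/-- … hence its datum is a Stage-13 datum of record. [cite: Balaban1989LargeFieldII, Thm 1 p.355 (bookkeeping)] -/
theorem IsRateKey₁₃CoPH.isDatumOfRecord₁₃CCoPH (hk : IsRateKey₁₃CoPH F N D w θ) : IsDatumOfRecord₁₃CCoPH F N D :=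
  isDatumOfRecord₁₃CCoPH_of_isRecordOfRecord₁₃CCoPH hk.isRecordOfRecord₁₃CCoPH

/-- The key CERTIFIES θ's provisos and admissibility and realises `D` as θ's datum of record. [cite: Balaban1989LargeFieldI, (0.3)–(0.4) p.176 (bookkeeping)] -/
theorem IsRateKey₁₃CoPH.exists_provisos (hk : IsRateKey₁₃CoPH F N D w θ) : ∃ h : θ.Provisos₁₃CoPH F N, θ.Admissible F N ∧ D = datumOfRecord₁₃CoPH F N θ h := by
  obtain ⟨h, hθ, hD, -⟩ := hk
  exact ⟨h, hθ, hD⟩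

/-- The key's θ is admissible. [cite: Balaban1987RG1, (1.20)–(1.21) p.264 (hypothesis dictionary; bookkeeping)] -/
theorem IsRateKey₁₃CoPH.admissible (hk : IsRateKey₁₃CoPH F N D w θ) : θ.Admissible F N := by
  obtain ⟨-, hθ, -⟩ := hk
  exact hθ

/-- The world's window is positive. [cite: Balaban1987RG1, Thm 1 p.259 (bookkeeping)] -/
theorem IsRateKey₁₃CoPH.gamma_pos (hk : IsRateKey₁₃CoPH F N D w θ) : 0 < w.γ := by
  obtain ⟨-, -, -, -, hγ, -⟩ := hk
  exact hγ.1

/-- The world's window sits inside θ's coupling window: `w.γ ≤ θ.γ`. [cite: Balaban1987RG1, Thm 1 p.259 (bookkeeping)] -/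
theorem IsRateKey₁₃CoPH.gamma_le (hk : IsRateKey₁₃CoPH F N D w θ) : w.γ ≤ θ.γ := by
  obtain ⟨-, -, -, -, hγ, -⟩ := hk
  exact hγ.2

/-- The world reads θ's block factor. [cite: Balaban1987RG1, (0.1) p.251 (bookkeeping)] -/
theorem IsRateKey₁₃CoPH.L_eq (hk : IsRateKey₁₃CoPH F N D w θ) : w.L = (θ.L : ℝ) := by
  obtain ⟨-, -, -, -, -, hL, -⟩ := hk
  exact hL

/-- The world is bound to the datum's construction. [cite: Balaban1989LargeFieldII, Thm 1 + (0.1) pp.355–356 (bookkeeping)] -/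
theorem IsRateKey₁₃CoPH.construction_eq (hk : IsRateKey₁₃CoPH F N D w θ) : w.C = D.C := by
  obtain ⟨-, -, -, hC, -⟩ := hk
  exact hC

/-- The upstream block of the world is the C-binding of record at the Stage-13 view. [cite: Balaban1989LargeFieldII, Thm 1 + (0.1) pp.355–356 (bookkeeping)] -/
theorem IsRateKey₁₃CoPH.up_eq (hk : IsRateKey₁₃CoPH F N D w θ) (P : B12.RunParams) : w.up P = upOfRecord₅C F N (θ.toStage5₁₃CoPH F N) P := by
  obtain ⟨-, -, -, -, -, -, hup⟩ := hk
  exact hup P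

end Key


/-! ## §4. «`D` is a datum of record, Stage 13, realised IN THE REGIME `Rg`» and its canonical parameter in the regime -/

section DatumKeyOn

variable (F : T4Family) (N : ℕ) [NeZero N]

/-- **«`D` is a datum of record, Stage 13, realised in the regime `Rg`»**: SOME admissible Stage-13 parameter tuple IN `Rg` satisfying its displayed provisos has `D` as its datum
of record — the common key prefix of the regime-restricted carrier homes (the Stage-13 re-keys of `YMDAG.UVSplit.RRec₁₂On 𝔯 Rg` ∕ `SRec₁₂On cr Rg`).  At `Rg := ⊤` it is the C key (`isDatumOfRecord₁₃CCoPHOn_true_iff`).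
[cite: Balaban1989LargeFieldII, Thm 1 + (0.1) pp.355–356; Balaban1988Convergent, Thms 1–2 pp.262–263 (objects of record; bookkeeping)] -/
def IsDatumOfRecord₁₃CCoPHOn (Rg : (F : T4Family) → Stage13HParams F N → Prop) (D : FiniteEpsData F (SU N)) : Prop :=
  ∃ (θ : Stage13HParams F N) (h : θ.Provisos₁₃CoPH F N), Rg F θ ∧ θ.Admissible F N ∧ D = datumOfRecord₁₃CoPH F N θ h

variable (Rg : (F : T4Family) → Stage13HParams F N → Prop)

/-- Unfolding (`Iff.rfl`). [cite: Balaban1989LargeFieldII, Thm 1 + (0.1) pp.355–356 (bookkeeping)] -/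
theorem isDatumOfRecord₁₃CCoPHOn_iff (D : FiniteEpsData F (SU N)) :
    IsDatumOfRecord₁₃CCoPHOn F N Rg D ↔ ∃ (θ : Stage13HParams F N) (h : θ.Provisos₁₃CoPH F N), Rg F θ ∧ θ.Admissible F N ∧ D = datumOfRecord₁₃CoPH F N θ h :=
  Iff.rfl

/-- Every admissible Stage-13 parameter tuple in the regime with provisos yields a datum of record in the regime. [cite: Balaban1989LargeFieldII, Thm 1 + (0.1) pp.355–356 (bookkeeping)] -/
theorem isDatumOfRecord₁₃CCoPHOn_datumOfRecord₁₃CoPH (θ : Stage13HParams F N) (h : θ.Provisos₁₃CoPH F N) (hRg : Rg F θ) (hθ : θ.Admissible F N) :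
    IsDatumOfRecord₁₃CCoPHOn F N Rg (datumOfRecord₁₃CoPH F N θ h) :=
  ⟨θ, h, hRg, hθ, rfl⟩

/-- **THE HONEST REDUCTION, IN THE REGIME**: some datum of record in `Rg` exists at `(F, N)` iff SOME Stage-13 parameter tuple satisfies every displayed proviso, lies in `Rg` and
is admissible; inhabitation is NOT claimed in this module. [cite: Balaban1988Convergent, (2.7) p.255, (2.21) p.258, (3.16)–(3.22) pp.268–269; Balaban1987RG1, (1.12)–(1.15) p.262 (hypothesis dictionary; bookkeeping)] -/
theorem exists_isDatumOfRecord₁₃CCoPHOn_iff_exists_params :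
    (∃ D : FiniteEpsData F (SU N), IsDatumOfRecord₁₃CCoPHOn F N Rg D) ↔ ∃ θ : Stage13HParams F N, θ.Provisos₁₃CoPH F N ∧ Rg F θ ∧ θ.Admissible F N := by
  constructor
  · rintro ⟨_, θ, hP, hRg, hθ, -⟩
    exact ⟨θ, hP, hRg, hθ⟩
  · rintro ⟨θ, hP, hRg, hθ⟩
    exact ⟨_, isDatumOfRecord₁₃CCoPHOn_datumOfRecord₁₃CoPH F N Rg θ hP hRg hθ⟩

/-- **A PROPERTY OF EVERY DATUM OF RECORD IN THE REGIME ⟺ THE θ-KEYED SENTENCE GUARDED BY `Rg`** (datum level). [cite: Balaban1989LargeFieldII, Thm 1 + (0.1) pp.355–356 (bookkeeping)] -/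
theorem forall_isDatumOfRecord₁₃CCoPHOn_iff (P : FiniteEpsData F (SU N) → Prop) :
    (∀ D : FiniteEpsData F (SU N), IsDatumOfRecord₁₃CCoPHOn F N Rg D → P D) ↔
      ∀ (θ : Stage13HParams F N) (h : θ.Provisos₁₃CoPH F N), Rg F θ → θ.Admissible F N → P (datumOfRecord₁₃CoPH F N θ h) := by
  constructor
  · intro hall θ h hRg hθ
    exact hall _ (isDatumOfRecord₁₃CCoPHOn_datumOfRecord₁₃CoPH F N Rg θ h hRg hθ)
  · rintro hall D ⟨θ, h, hRg, hθ, rfl⟩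
    exact hall θ h hRg hθ

variable {F N Rg}
variable {D : FiniteEpsData F (SU N)}

/-- The regime forgotten: a datum of record in `Rg` is a datum of record (C key). [cite: Balaban1989LargeFieldII, Thm 1 p.355 (bookkeeping)] -/
theorem IsDatumOfRecord₁₃CCoPHOn.toC (h : IsDatumOfRecord₁₃CCoPHOn F N Rg D) : IsDatumOfRecord₁₃CCoPH F N D := by
  obtain ⟨θ, hP, -, hθ, hD⟩ := h
  exact ⟨θ, hP, hθ, hD⟩

/-- Monotone in the regime. [cite: Balaban1989LargeFieldII, Thm 1 p.355 (bookkeeping)] -/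
theorem IsDatumOfRecord₁₃CCoPHOn.mono {Rg' : (F : T4Family) → Stage13HParams F N → Prop} (hle : ∀ (F : T4Family) (θ : Stage13HParams F N), Rg F θ → Rg' F θ)
    (h : IsDatumOfRecord₁₃CCoPHOn F N Rg D) : IsDatumOfRecord₁₃CCoPHOn F N Rg' D := by
  obtain ⟨θ, hP, hRg, hθ, hD⟩ := h
  exact ⟨θ, hP, hle F θ hRg, hθ, hD⟩

/-- At the trivial regime the key IS the C key. [cite: Balaban1989LargeFieldII, Thm 1 p.355 (bookkeeping)] -/
theorem isDatumOfRecord₁₃CCoPHOn_true_iff : IsDatumOfRecord₁₃CCoPHOn F N (fun _ _ => True) D ↔ IsDatumOfRecord₁₃CCoPH F N D :=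
  ⟨fun h => h.toC, fun ⟨θ, hP, hθ, hD⟩ => ⟨θ, hP, trivial, hθ, hD⟩⟩

/-- A datum of record whose C-CANONICAL parameter lies in the regime is a datum of record in the regime (companion of the (T-RATE) home's `rRec₁₂On_of_regime_params`, re-keyed).
[cite: Balaban1989LargeFieldII, Thm 1 p.355 (bookkeeping)] -/
theorem IsDatumOfRecord₁₃CCoPH.isDatumOfRecord₁₃CCoPHOn_of_regime_params (h : IsDatumOfRecord₁₃CCoPH F N D) (hRg : Rg F h.params) : IsDatumOfRecord₁₃CCoPHOn F N Rg D :=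
  ⟨h.params, h.provisos, hRg, h.admissible, h.eq_datumOfRecord₁₃CoPH⟩

/-- **THE CANONICAL STAGE-13 PARAMETER OF A DATUM OF RECORD IN THE REGIME** (choice).  HONEST: it need not equal the C-canonical parameter `h.toC.params` of the same datum
(two choices over two existentials); the regime reaches THIS parameter (`.regime`), never `IsDatumOfRecord₁₃CCoPH.params`. [cite: Balaban1989LargeFieldII, Thm 1 + (0.1) pp.355–356 (bookkeeping)] -/
def IsDatumOfRecord₁₃CCoPHOn.params (h : IsDatumOfRecord₁₃CCoPHOn F N Rg D) : Stage13HParams F N :=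
  Classical.choose h

/-- Its provisos. [cite: Balaban1988Convergent, (2.7) p.255, (2.21) p.258, (2.35) p.261 (bookkeeping)] -/
theorem IsDatumOfRecord₁₃CCoPHOn.provisos (h : IsDatumOfRecord₁₃CCoPHOn F N Rg D) : h.params.Provisos₁₃CoPH F N :=
  (Classical.choose_spec h).fst

/-- **It lies IN THE REGIME.** [cite: Balaban1988Convergent, (3.16)–(3.22) pp.268–269 (bookkeeping)] -/
theorem IsDatumOfRecord₁₃CCoPHOn.regime (h : IsDatumOfRecord₁₃CCoPHOn F N Rg D) : Rg F h.params :=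
  (Classical.choose_spec h).snd.1

/-- Its admissibility. [cite: Balaban1987RG1, (1.12) p.262; Balaban1988Convergent, (2.10) p.256 (bookkeeping)] -/
theorem IsDatumOfRecord₁₃CCoPHOn.admissible (h : IsDatumOfRecord₁₃CCoPHOn F N Rg D) : h.params.Admissible F N :=
  (Classical.choose_spec h).snd.2.1

/-- **The datum IS the datum of record of its canonical parameter in the regime.** [cite: Balaban1989LargeFieldII, Thm 1 p.355 (bookkeeping)] -/
theorem IsDatumOfRecord₁₃CCoPHOn.eq_datumOfRecord₁₃CoPH (h : IsDatumOfRecord₁₃CCoPHOn F N Rg D) : D = datumOfRecord₁₃CoPH F N h.params h.provisos :=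
  (Classical.choose_spec h).snd.2.2

/-- The canonical parameter realises a C-datum key of `D` (pointed form; its `.params` is NOT asserted to be `h.params`). [cite: Balaban1989LargeFieldII, Thm 1 p.355 (bookkeeping)] -/
theorem IsDatumOfRecord₁₃CCoPHOn.isDatumOfRecord₁₃CCoPH_params (h : IsDatumOfRecord₁₃CCoPHOn F N Rg D) :
    IsDatumOfRecord₁₃CCoPH F N (datumOfRecord₁₃CoPH F N h.params h.provisos) :=
  isDatumOfRecord₁₃CCoPH_datumOfRecord₁₃CoPH F N h.params h.provisos h.admissible

/-- The canonical parameter's coupling window is positive. [cite: Balaban1987RG1, (0.21) p.256 (bookkeeping)] -/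
theorem IsDatumOfRecord₁₃CCoPHOn.gamma_pos (h : IsDatumOfRecord₁₃CCoPHOn F N Rg D) : 0 < h.params.γ :=
  h.admissible.toStage9.gamma_pos

/-- … and lies inside `]0, 1[`. [cite: Balaban1988Convergent, (2.28) p.259 (bookkeeping)] -/
theorem IsDatumOfRecord₁₃CCoPHOn.gamma_lt_one (h : IsDatumOfRecord₁₃CCoPHOn F N Rg D) : h.params.γ < 1 :=
  h.admissible.toStage12.pos₁₂.2.2.2.2

/-- The canonical parameter in the regime depends on the datum only. [cite: Balaban1989LargeFieldII, Thm 1 + (0.1) pp.355–356 (bookkeeping)] -/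
theorem IsDatumOfRecord₁₃CCoPHOn.params_congr {D' : FiniteEpsData F (SU N)} (h : IsDatumOfRecord₁₃CCoPHOn F N Rg D) (h' : IsDatumOfRecord₁₃CCoPHOn F N Rg D') (e : D = D') :
    h.params = h'.params := by
  subst e
  rfl

/-- **WHAT A CONSUMER PROVES IN THE REGIME ⟹ WHAT THE INSTANCE CARRIES**: a property of the objects of record established at EVERY admissible Stage-13 parameter tuple IN `Rg` with
provisos holds at the canonical parameter in the regime of every datum of record in the regime — the regime is AVAILABLE as a hypothesis. [cite: Balaban1989LargeFieldII, Thm 1 p.355 (bookkeeping)] -/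
theorem IsDatumOfRecord₁₃CCoPHOn.forall_params {P : (D : FiniteEpsData F (SU N)) → (θ : Stage13HParams F N) → θ.Provisos₁₃CoPH F N → Prop}
    (hP : ∀ (θ : Stage13HParams F N) (hθ : θ.Provisos₁₃CoPH F N), Rg F θ → θ.Admissible F N → P (datumOfRecord₁₃CoPH F N θ hθ) θ hθ) (h : IsDatumOfRecord₁₃CCoPHOn F N Rg D) :
    P D h.params h.provisos := by
  have := hP h.params h.provisos h.regime h.admissible
  rwa [← h.eq_datumOfRecord₁₃CoPH] at this

/-- The datum's β-functions are the Stage-13 β of record at the canonical parameter. [cite: Balaban1987RG1, (1.20)–(1.22) p.264 (bookkeeping)] -/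
theorem IsDatumOfRecord₁₃CCoPHOn.βfun_eq_betaOfRecord₁₃ (h : IsDatumOfRecord₁₃CCoPHOn F N Rg D) : D.βfun = betaOfRecord₁₃ F N h.params.toStage13Params := by
  have := βfun_datumOfRecord₁₃CoPH F N h.params h.provisos
  rwa [← h.eq_datumOfRecord₁₃CoPH] at this

/-- The datum's coupling flow of the run `p` IS the Stage-13 generated history of record of the canonical parameter. [cite: Balaban1987RG1, (0.17)–(0.20) pp.255–256 (bookkeeping)] -/
theorem IsDatumOfRecord₁₃CCoPHOn.flow_g (h : IsDatumOfRecord₁₃CCoPHOn F N Rg D) (p : B12.RunParams) :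
    (D.C p).flow.g = gOfRecord₁₃ F N h.params.toStage13Params p := by
  have := flow_g_datumOfRecord₁₃CoPH F N h.params h.provisos p
  rwa [← h.eq_datumOfRecord₁₃CoPH] at this

/-- A datum of record in the regime is a datum of record, Stage 0. [cite: Balaban1987RG1, (0.3)–(0.4) p.253 (bookkeeping)] -/
theorem IsDatumOfRecord₁₃CCoPHOn.isDatumOfRecord₀ (h : IsDatumOfRecord₁₃CCoPHOn F N Rg D) : IsDatumOfRecord₀ F N D :=
  h.toC.isDatumOfRecord₀


end DatumKeyOn

/-! ## §5. «`(D, w)` is a Stage-13 record realised IN THE REGIME `Rg`»; world companions; the θ-keyed guarded junction -/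

section RecordKeyOn

variable (F : T4Family) (N : ℕ) [NeZero N]

/-- **«`(D, w)` is a Stage-13 record (C-class) realised in the regime `Rg`»**: `IsRecordOfRecord₁₃CCoPH F N D w`'s body (the θ-exposed key `IsRateKey₁₃CoPH`) with the parameter IN
`Rg` — the regime-restricted record class a guarded composer quantifies over (`Spine`, `S_R00x`, `S_N27x` at `fun F D w => IsRecordOfRecord₁₃CCoPHOn F N Rg D w`).  At `Rg := ⊤` it is
`IsRecordOfRecord₁₃CCoPH` (`isRecordOfRecord₁₃CCoPHOn_true_iff`). [cite: Balaban1989LargeFieldII, Thm 1 + (0.1) pp.355–356; Balaban1987RG1, (0.24)–(0.25) p.257 (objects of record; bookkeeping)] -/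
def IsRecordOfRecord₁₃CCoPHOn (Rg : (F : T4Family) → Stage13HParams F N → Prop) (D : FiniteEpsData F (SU N)) (w : WorldP) : Prop :=
  ∃ θ : Stage13HParams F N, Rg F θ ∧ IsRateKey₁₃CoPH F N D w θ

variable (Rg : (F : T4Family) → Stage13HParams F N → Prop)

/-- Unfolding (`Iff.rfl`). [cite: Balaban1989LargeFieldII, Thm 1 + (0.1) pp.355–356 (bookkeeping)] -/
theorem isRecordOfRecord₁₃CCoPHOn_iff (D : FiniteEpsData F (SU N)) (w : WorldP) :
    IsRecordOfRecord₁₃CCoPHOn F N Rg D w ↔ ∃ θ : Stage13HParams F N, Rg F θ ∧ IsRateKey₁₃CoPH F N D w θ :=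
  Iff.rfl

/-- **Every admissible θ in the regime with provisos is a record in the regime at some world with any window `0 < γw ≤ θ.γ`.** [cite: Balaban1989LargeFieldII, Thm 1 + (0.1) pp.355–356 (bookkeeping)] -/
theorem exists_world_isRecordOfRecord₁₃CCoPHOn (θ : Stage13HParams F N) (h : θ.Provisos₁₃CoPH F N) (hRg : Rg F θ) (hθ : θ.Admissible F N) {γw : ℝ}
    (hγw : 0 < γw ∧ γw ≤ θ.γ) : ∃ w : WorldP, IsRecordOfRecord₁₃CCoPHOn F N Rg (datumOfRecord₁₃CoPH F N θ h) w ∧ w.γ = γw := by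
  obtain ⟨w, hk, hγ⟩ := exists_world_isRateKey₁₃CoPH F N θ h hθ hγw
  exact ⟨w, ⟨θ, hRg, hk⟩, hγ⟩

/-- Some datum of record in the regime exists iff some record in the regime exists. [cite: Balaban1989LargeFieldII, Thm 1 + (0.1) pp.355–356 (bookkeeping)] -/
theorem exists_isDatumOfRecord₁₃CCoPHOn_iff_exists_record :
    (∃ D : FiniteEpsData F (SU N), IsDatumOfRecord₁₃CCoPHOn F N Rg D) ↔ ∃ (D : FiniteEpsData F (SU N)) (w : WorldP), IsRecordOfRecord₁₃CCoPHOn F N Rg D w := by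
  constructor
  · rintro ⟨_, θ, hP, hRg, hθ, rfl⟩
    obtain ⟨w, hw, -⟩ := exists_world_isRecordOfRecord₁₃CCoPHOn F N Rg θ hP hRg hθ ⟨hθ.toStage9.gamma_pos, le_rfl⟩
    exact ⟨_, w, hw⟩
  · rintro ⟨D, w, θ, hRg, hk⟩
    obtain ⟨hP, hθ, hD⟩ := hk.exists_provisos
    exact ⟨D, θ, hP, hRg, hθ, hD⟩

/-- **A WORLD-BLIND PROPERTY AT EVERY RECORD IN THE REGIME ⟺ THE θ-KEYED SENTENCE GUARDED BY `Rg`** — the junction between a composer's conclusion over the regime-restricted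
record class (e.g. `YMDAG.UVSplit.Spine` at `IsRecordOfRecord₁₃CCoPHOn F N Rg`) and an item text «`∀ θ (h : θ.Provisos₁₃CoPH F N), Rg F θ → θ.Admissible F N → P (datumOfRecord₁₃CoPH F N θ h)`».
[cite: Balaban1989LargeFieldII, Thm 1 + (0.1) pp.355–356 (bookkeeping)] -/
theorem forall_isRecordOfRecord₁₃CCoPHOn_iff (P : FiniteEpsData F (SU N) → Prop) :
    (∀ (D : FiniteEpsData F (SU N)) (w : WorldP), IsRecordOfRecord₁₃CCoPHOn F N Rg D w → P D) ↔
      ∀ (θ : Stage13HParams F N) (h : θ.Provisos₁₃CoPH F N), Rg F θ → θ.Admissible F N → P (datumOfRecord₁₃CoPH F N θ h) := by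
  constructor
  · intro hall θ h hRg hθ
    obtain ⟨w, hw, -⟩ := exists_world_isRecordOfRecord₁₃CCoPHOn F N Rg θ h hRg hθ ⟨hθ.toStage9.gamma_pos, le_rfl⟩
    exact hall _ w hw
  · rintro hall D w ⟨θ, hRg, hk⟩
    obtain ⟨h, hθ, rfl⟩ := hk.exists_provisos
    exact hall θ h hRg hθ

variable {F N Rg}
variable {D : FiniteEpsData F (SU N)} {w : WorldP}

/-- The regime forgotten: a record in the regime is a Stage-13 record. [cite: Balaban1989LargeFieldII, Thm 1 p.355 (bookkeeping)] -/
theorem IsRecordOfRecord₁₃CCoPHOn.isRecordOfRecord₁₃CCoPH (h : IsRecordOfRecord₁₃CCoPHOn F N Rg D w) : IsRecordOfRecord₁₃CCoPH F N D w := by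
  obtain ⟨θ, -, hk⟩ := h
  exact hk.isRecordOfRecord₁₃CCoPH

/-- Its datum is a datum of record in the regime. [cite: Balaban1989LargeFieldII, Thm 1 p.355 (bookkeeping)] -/
theorem IsRecordOfRecord₁₃CCoPHOn.isDatumOfRecord₁₃CCoPHOn (h : IsRecordOfRecord₁₃CCoPHOn F N Rg D w) : IsDatumOfRecord₁₃CCoPHOn F N Rg D := by
  obtain ⟨θ, hRg, hk⟩ := h
  obtain ⟨hP, hθ, hD⟩ := hk.exists_provisos
  exact ⟨θ, hP, hRg, hθ, hD⟩

/-- **THE TUPLE IN THE REGIME BEHIND A RECORD IN THE REGIME** — exactly the hypothesis shape of the (T-RATE) home's `s_R00x_rRec₁₂On_of_regime` (to be re-keyed at ₁₃) («every record of `Rec` comes with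
an admissible tuple with provisos in the regime realising `D`»): ONE application. [cite: Balaban1989LargeFieldII, Thm 1 + (0.1) pp.355–356 (bookkeeping)] -/
theorem IsRecordOfRecord₁₃CCoPHOn.exists_regime_tuple (h : IsRecordOfRecord₁₃CCoPHOn F N Rg D w) :
    ∃ (θ : Stage13HParams F N) (hP : θ.Provisos₁₃CoPH F N), Rg F θ ∧ θ.Admissible F N ∧ D = datumOfRecord₁₃CoPH F N θ hP :=
  h.isDatumOfRecord₁₃CCoPHOn

/-- Monotone in the regime. [cite: Balaban1989LargeFieldII, Thm 1 p.355 (bookkeeping)] -/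
theorem IsRecordOfRecord₁₃CCoPHOn.mono {Rg' : (F : T4Family) → Stage13HParams F N → Prop} (hle : ∀ (F : T4Family) (θ : Stage13HParams F N), Rg F θ → Rg' F θ)
    (h : IsRecordOfRecord₁₃CCoPHOn F N Rg D w) : IsRecordOfRecord₁₃CCoPHOn F N Rg' D w := by
  obtain ⟨θ, hRg, hk⟩ := h
  exact ⟨θ, hle F θ hRg, hk⟩

/-- The world's window is positive. [cite: Balaban1987RG1, Thm 1 p.259 (bookkeeping)] -/
theorem IsRecordOfRecord₁₃CCoPHOn.gamma_pos (h : IsRecordOfRecord₁₃CCoPHOn F N Rg D w) : 0 < w.γ := by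
  obtain ⟨θ, -, hk⟩ := h
  exact hk.gamma_pos

/-- The world is bound to the datum's construction. [cite: Balaban1989LargeFieldII, Thm 1 + (0.1) pp.355–356 (bookkeeping)] -/
theorem IsRecordOfRecord₁₃CCoPHOn.construction_eq (h : IsRecordOfRecord₁₃CCoPHOn F N Rg D w) : w.C = D.C := by
  obtain ⟨θ, -, hk⟩ := h
  exact hk.construction_eq

/-- A Stage-13 record keyed at a θ IN THE REGIME is a record in the regime (pointed intro). [cite: Balaban1989LargeFieldII, Thm 1 + (0.1) pp.355–356 (bookkeeping)] -/
theorem IsRateKey₁₃CoPH.isRecordOfRecord₁₃CCoPHOn {θ : Stage13HParams F N} (hk : IsRateKey₁₃CoPH F N D w θ) (hRg : Rg F θ) : IsRecordOfRecord₁₃CCoPHOn F N Rg D w :=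
  ⟨θ, hRg, hk⟩

/-- At the trivial regime the record key IS `IsRecordOfRecord₁₃CCoPH`. [cite: Balaban1989LargeFieldII, Thm 1 p.355 (bookkeeping)] -/
theorem isRecordOfRecord₁₃CCoPHOn_true_iff : IsRecordOfRecord₁₃CCoPHOn F N (fun _ _ => True) D w ↔ IsRecordOfRecord₁₃CCoPH F N D w :=
  ⟨fun h => h.isRecordOfRecord₁₃CCoPH, fun ⟨θ, hk⟩ => ⟨θ, trivial, hk⟩⟩

/-- **DATUM OF RECORD IN THE REGIME ⟺ RECORD IN THE REGIME AT SOME WORLD.** [cite: Balaban1989LargeFieldII, Thm 1 + (0.1) pp.355–356 (bookkeeping)] -/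
theorem isDatumOfRecord₁₃CCoPHOn_iff_exists_world : IsDatumOfRecord₁₃CCoPHOn F N Rg D ↔ ∃ w : WorldP, IsRecordOfRecord₁₃CCoPHOn F N Rg D w := by
  constructor
  · rintro ⟨θ, hP, hRg, hθ, rfl⟩
    obtain ⟨w, hw, -⟩ := exists_world_isRecordOfRecord₁₃CCoPHOn F N Rg θ hP hRg hθ ⟨hθ.toStage9.gamma_pos, le_rfl⟩
    exact ⟨w, hw⟩
  · rintro ⟨w, hw⟩
    exact hw.isDatumOfRecord₁₃CCoPHOn

/-- **WORLD COMPANION IN THE REGIME AT ANY WINDOW BELOW THE CANONICAL ONE** (what an N17-type home-keying binder consumes once the U3 radius is pinned in `]0, h.params.γ]`).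
[cite: Balaban1989LargeFieldII, Thm 1 + (0.1) pp.355–356 (bookkeeping)] -/
theorem IsDatumOfRecord₁₃CCoPHOn.exists_world (h : IsDatumOfRecord₁₃CCoPHOn F N Rg D) {γw : ℝ} (hγw : 0 < γw ∧ γw ≤ h.params.γ) :
    ∃ w : WorldP, IsRecordOfRecord₁₃CCoPHOn F N Rg D w ∧ w.γ = γw := by
  obtain ⟨w, hw, hγ⟩ := exists_world_isRecordOfRecord₁₃CCoPHOn F N Rg h.params h.provisos h.regime h.admissible hγw
  exact ⟨w, h.eq_datumOfRecord₁₃CoPH ▸ hw, hγ⟩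

/-- … in particular at the canonical window itself. [cite: Balaban1989LargeFieldII, Thm 1 + (0.1) pp.355–356 (bookkeeping)] -/
theorem IsDatumOfRecord₁₃CCoPHOn.exists_world_gamma (h : IsDatumOfRecord₁₃CCoPHOn F N Rg D) :
    ∃ w : WorldP, IsRecordOfRecord₁₃CCoPHOn F N Rg D w ∧ w.γ = h.params.γ :=
  h.exists_world ⟨h.gamma_pos, le_rfl⟩

/-- The ₅C shadow at the canonical parameter in the regime (for consumers keyed at ₅C). [cite: Balaban1989LargeFieldII, Thm 1 + (0.1) pp.355–356 (bookkeeping)] -/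
theorem IsDatumOfRecord₁₃CCoPHOn.exists_isRecordOfRecord₅C (h : IsDatumOfRecord₁₃CCoPHOn F N Rg D) :
    ∃ (D₅ : FiniteEpsData F (SU N)) (w : WorldP), IsRecordOfRecord₅C F N D₅ w ∧ D₅.C = D.C ∧ (∀ K g₀ k, D₅.dens K g₀ k = D.dens K g₀ k) ∧
      D₅.βfun = D.βfun ∧ D₅.av = D.av :=
  h.toC.exists_isRecordOfRecord₅C

end RecordKeyOn

/-! ## §6. Canonicalised readings RELATIVE TO THE REGIME — coherence for regime homes keyed «`∃ θ hP, Rg F θ ∧ θ.Admissible F N ∧ D = datumOfRecord₁₃CoPH F N θ hP ∧ S = cr F θ hP …`»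

As `canon₁₃CoPH` (gen 2) for the C key: reading a regime-keyed record through `canon₁₃CoPHOn Rg f` makes the admitted bundle a function of the DATUM, read at the canonical parameter IN
THE REGIME, so two regime homes read through `canon₁₃CoPHOn Rg` admit, at the same `(F, D, g₀, os)`, bundles read at ONE parameter (`exists_keyed_canon₁₃CoPHOn_iff`,
`keyed_canon₁₃CoPHOn_coherent`).  Off the class `canon₁₃CoPHOn Rg f = f`. -/
section CanonOn

variable (F : T4Family) (N : ℕ) [NeZero N] (Rg : (F : T4Family) → Stage13HParams F N → Prop) {α : Sort*}

/-- **CANONICALISED READING RELATIVE TO THE REGIME**: read `f` at the canonical parameter in `Rg` of the datum `datumOfRecord₁₃CoPH F N θ hP` when that datum is of record in the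
regime, else at `(θ, hP)` itself.  Kernel bookkeeping (`Classical.dec`, `dite`). [cite: Balaban1989LargeFieldII, Thm 1 + (0.1) pp.355–356 (bookkeeping)] -/
def canon₁₃CoPHOn (f : (θ : Stage13HParams F N) → θ.Provisos₁₃CoPH F N → α) (θ : Stage13HParams F N) (hP : θ.Provisos₁₃CoPH F N) : α := by
  classical
  exact if h : IsDatumOfRecord₁₃CCoPHOn F N Rg (datumOfRecord₁₃CoPH F N θ hP) then f h.params h.provisos else f θ hP

variable {F N Rg}

/-- **`canon₁₃CoPHOn Rg f θ hP = f h.params h.provisos`** whenever `(θ, hP)` realises a datum of record in the regime `D` with key `h`. [cite: Balaban1989LargeFieldII, Thm 1 + (0.1) pp.355–356 (bookkeeping)] -/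
theorem canon₁₃CoPHOn_eq_of_eq {f : (θ : Stage13HParams F N) → θ.Provisos₁₃CoPH F N → α} {D : FiniteEpsData F (SU N)} (h : IsDatumOfRecord₁₃CCoPHOn F N Rg D)
    (θ : Stage13HParams F N) (hP : θ.Provisos₁₃CoPH F N) (e : D = datumOfRecord₁₃CoPH F N θ hP) :
    canon₁₃CoPHOn F N Rg f θ hP = f h.params h.provisos := by
  subst e
  unfold canon₁₃CoPHOn
  rw [dif_pos h]

/-- At the canonical parameter in the regime `canon₁₃CoPHOn Rg f` reads `f`. [cite: Balaban1989LargeFieldII, Thm 1 + (0.1) pp.355–356 (bookkeeping)] -/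
theorem canon₁₃CoPHOn_params {f : (θ : Stage13HParams F N) → θ.Provisos₁₃CoPH F N → α} {D : FiniteEpsData F (SU N)} (h : IsDatumOfRecord₁₃CCoPHOn F N Rg D) :
    canon₁₃CoPHOn F N Rg f h.params h.provisos = f h.params h.provisos :=
  canon₁₃CoPHOn_eq_of_eq h h.params h.provisos h.eq_datumOfRecord₁₃CoPH

/-- At an admissible tuple IN THE REGIME with provisos, `canon₁₃CoPHOn Rg f` reads `f` at the canonical parameter in the regime of ITS datum. [cite: Balaban1989LargeFieldII, Thm 1 + (0.1) pp.355–356 (bookkeeping)] -/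
theorem canon₁₃CoPHOn_eq_of_regime {f : (θ : Stage13HParams F N) → θ.Provisos₁₃CoPH F N → α} (θ : Stage13HParams F N) (hP : θ.Provisos₁₃CoPH F N) (hRg : Rg F θ)
    (hθ : θ.Admissible F N) :
    canon₁₃CoPHOn F N Rg f θ hP = f (isDatumOfRecord₁₃CCoPHOn_datumOfRecord₁₃CoPH F N Rg θ hP hRg hθ).params (isDatumOfRecord₁₃CCoPHOn_datumOfRecord₁₃CoPH F N Rg θ hP hRg hθ).provisos :=
  canon₁₃CoPHOn_eq_of_eq _ θ hP rfl

/-- Off the class nothing is canonicalised. [cite: Balaban1989LargeFieldII, Thm 1 + (0.1) pp.355–356 (bookkeeping)] -/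
theorem canon₁₃CoPHOn_eq_self_of_not {f : (θ : Stage13HParams F N) → θ.Provisos₁₃CoPH F N → α} (θ : Stage13HParams F N) (hP : θ.Provisos₁₃CoPH F N)
    (hn : ¬ IsDatumOfRecord₁₃CCoPHOn F N Rg (datumOfRecord₁₃CoPH F N θ hP)) : canon₁₃CoPHOn F N Rg f θ hP = f θ hP := by
  unfold canon₁₃CoPHOn
  rw [dif_neg hn]

/-- **THE KEYED-RECORD FACE, IN THE REGIME**: a regime-keyed record read through `canon₁₃CoPHOn Rg f` IS the datum-keyed record «the bundle reads `f` at the canonical parameter in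
the regime of `D`», for every property `Φ` of the reading. [cite: Balaban1989LargeFieldII, Thm 1 + (0.1) pp.355–356 (bookkeeping)] -/
theorem exists_keyed_canon₁₃CoPHOn_iff {f : (θ : Stage13HParams F N) → θ.Provisos₁₃CoPH F N → α} {D : FiniteEpsData F (SU N)} (Φ : α → Prop) :
    (∃ (θ : Stage13HParams F N) (hP : θ.Provisos₁₃CoPH F N), Rg F θ ∧ θ.Admissible F N ∧ D = datumOfRecord₁₃CoPH F N θ hP ∧ Φ (canon₁₃CoPHOn F N Rg f θ hP)) ↔
      ∃ h : IsDatumOfRecord₁₃CCoPHOn F N Rg D, Φ (f h.params h.provisos) := by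
  constructor
  · rintro ⟨θ, hP, hRg, hθ, e, hΦ⟩
    have h : IsDatumOfRecord₁₃CCoPHOn F N Rg D := ⟨θ, hP, hRg, hθ, e⟩
    refine ⟨h, ?_⟩
    rwa [canon₁₃CoPHOn_eq_of_eq (f := f) h θ hP e] at hΦ
  · rintro ⟨h, hΦ⟩
    refine ⟨h.params, h.provisos, h.regime, h.admissible, h.eq_datumOfRecord₁₃CoPH, ?_⟩
    rwa [canon₁₃CoPHOn_params (f := f) h]

/-- **COHERENCE IN THE REGIME**: two regime-keyed records read through `canon₁₃CoPHOn Rg` admit, at the same datum, readings AT THE SAME PARAMETER.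
[cite: Balaban1989LargeFieldII, Thm 1 + (0.1) pp.355–356 (bookkeeping)] -/
theorem keyed_canon₁₃CoPHOn_coherent {β : Sort*} {f : (θ : Stage13HParams F N) → θ.Provisos₁₃CoPH F N → α} {g : (θ : Stage13HParams F N) → θ.Provisos₁₃CoPH F N → β}
    {D : FiniteEpsData F (SU N)} (Φ : α → Prop) (Ψ : β → Prop)
    (hΦ : ∃ (θ : Stage13HParams F N) (hP : θ.Provisos₁₃CoPH F N), Rg F θ ∧ θ.Admissible F N ∧ D = datumOfRecord₁₃CoPH F N θ hP ∧ Φ (canon₁₃CoPHOn F N Rg f θ hP))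
    (hΨ : ∃ (θ : Stage13HParams F N) (hP : θ.Provisos₁₃CoPH F N), Rg F θ ∧ θ.Admissible F N ∧ D = datumOfRecord₁₃CoPH F N θ hP ∧ Ψ (canon₁₃CoPHOn F N Rg g θ hP)) :
    ∃ h : IsDatumOfRecord₁₃CCoPHOn F N Rg D, Φ (f h.params h.provisos) ∧ Ψ (g h.params h.provisos) := by
  obtain ⟨h, h₁⟩ := (exists_keyed_canon₁₃CoPHOn_iff Φ).1 hΦ
  obtain ⟨h', h₂⟩ := (exists_keyed_canon₁₃CoPHOn_iff Ψ).1 hΨ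
  exact ⟨h, h₁, h₂⟩

end CanonOn

/-! ## §7. THE GUARD OF RECORD «partition of unity ∧ non-degenerate present slots» and the CN instances

The route's Stage-13 items (rev 16, to be minted) bundle `θ.ZhUnity F N` (print's partition of unity for the residual 𝐓-weights, [Balaban1988Convergent] (3.16)–(3.20)) and
`θ.SlotsNondegenerate₁₃ F N` (no present slot of record is the zero density, (3.22)) into ONE conjunction on the datum's own parameter.  Named once as a regime; the «CN key» is
§4–§6 at that regime. -/

section Guard

variable (F : T4Family) (N : ℕ) [NeZero N]

/-- **THE GUARD OF RECORD RE-ISSUED OVER THE HISTORY-INDEXED STRUCTURE, as a regime**: `θ.ZhUnity F N ∧ θ.SlotsNondegenerate₁₃ F N` — print's partition of unity for the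
history-indexed residual 𝐓-weights (def-T's `Stage13HParams.ZhUnity`, FILE 27 §0) AND non-degeneracy of the present slots (read through `toStage13Params`), ONE bundled
conjunction on the same `θ` (director-ym LINE №112; NOT a proviso: hypotheses a consumer takes and destructures).  The v1.2 guard `unityNondeg₁₃` of `Node00/Record13DatumKey`
(over `Stage13Params`, run-blind `ZtUnity`) and the v1.6 guard `unityNondeg₁₃R` of `Node00/Record13DatumKeyCoPR` (over `Stage13RParams`, run-indexed `ZrUnity`) are NOT citable
here; at the history-blind embedding the v1.6 guard GIVES this one (§8). [cite: Balaban1988Convergent, (3.16)–(3.20) pp.268–269, (3.22) p.269] -/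
abbrev unityNondeg₁₃H : (F : T4Family) → Stage13HParams F N → Prop :=
  fun F θ => θ.ZhUnity F N ∧ θ.SlotsNondegenerate₁₃ F N

/-- Unfolding (`Iff.rfl`). [cite: Balaban1988Convergent, (3.16)–(3.22) pp.268–269 (bookkeeping)] -/
theorem unityNondeg₁₃H_iff (θ : Stage13HParams F N) : unityNondeg₁₃H N F θ ↔ θ.ZhUnity F N ∧ θ.SlotsNondegenerate₁₃ F N :=
  Iff.rfl


/-- **THE CN KEY — «`D` is a datum of record, Stage 13, realised by an admissible tuple WITH print's partition of unity AND non-degenerate present slots»**: the datum key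
at the guard of record. [cite: Balaban1989LargeFieldII, Thm 1 + (0.1) pp.355–356; Balaban1988Convergent, (3.16)–(3.22) pp.268–269 (objects of record; bookkeeping)] -/
abbrev IsDatumOfRecord₁₃CCoPHN (D : FiniteEpsData F (SU N)) : Prop :=
  IsDatumOfRecord₁₃CCoPHOn F N (unityNondeg₁₃H N) D

/-- **THE CN RECORD CLASS** at the guard of record. [cite: Balaban1989LargeFieldII, Thm 1 + (0.1) pp.355–356; Balaban1988Convergent, (3.16)–(3.22) pp.268–269 (objects of record; bookkeeping)] -/
abbrev IsRecordOfRecord₁₃CCoPHN (D : FiniteEpsData F (SU N)) (w : WorldP) : Prop :=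
  IsRecordOfRecord₁₃CCoPHOn F N (unityNondeg₁₃H N) D w

/-- **The CN key, literally**: SOME Stage-13 parameter tuple with provisos, `(θ.ZhUnity F N ∧ θ.SlotsNondegenerate₁₃ F N)`, admissible, has `D` as its datum of record (`Iff.rfl`).
[cite: Balaban1989LargeFieldII, Thm 1 + (0.1) pp.355–356; Balaban1988Convergent, (3.16)–(3.22) pp.268–269 (bookkeeping)] -/
theorem isDatumOfRecord₁₃CCoPHN_iff (D : FiniteEpsData F (SU N)) :
    IsDatumOfRecord₁₃CCoPHN F N D ↔
      ∃ (θ : Stage13HParams F N) (h : θ.Provisos₁₃CoPH F N), (θ.ZhUnity F N ∧ θ.SlotsNondegenerate₁₃ F N) ∧ θ.Admissible F N ∧ D = datumOfRecord₁₃CoPH F N θ h :=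
  Iff.rfl

/-- **The CN record class, literally** (`Iff.rfl`). [cite: Balaban1989LargeFieldII, Thm 1 + (0.1) pp.355–356 (bookkeeping)] -/
theorem isRecordOfRecord₁₃CCoPHN_iff (D : FiniteEpsData F (SU N)) (w : WorldP) :
    IsRecordOfRecord₁₃CCoPHN F N D w ↔ ∃ θ : Stage13HParams F N, (θ.ZhUnity F N ∧ θ.SlotsNondegenerate₁₃ F N) ∧ IsRateKey₁₃CoPH F N D w θ :=
  Iff.rfl

/-- Intro at a guarded admissible tuple with provisos. [cite: Balaban1989LargeFieldII, Thm 1 + (0.1) pp.355–356 (bookkeeping)] -/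
theorem isDatumOfRecord₁₃CCoPHN_datumOfRecord₁₃CoPH (θ : Stage13HParams F N) (h : θ.Provisos₁₃CoPH F N) (hG : θ.ZhUnity F N ∧ θ.SlotsNondegenerate₁₃ F N) (hθ : θ.Admissible F N) :
    IsDatumOfRecord₁₃CCoPHN F N (datumOfRecord₁₃CoPH F N θ h) :=
  isDatumOfRecord₁₃CCoPHOn_datumOfRecord₁₃CoPH F N _ θ h hG hθ

/-- **K0′ READS THE SAME AT THE CN DATUM**: some CN datum of record exists at `(F, N)` iff SOME Stage-13 parameter tuple satisfies every displayed proviso, print's partition of unity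
and non-degeneracy of the present slots, and is admissible — the body of the route's `Record12Inhabited` (rev 15) at `(F, N)`, verbatim; inhabitation is NOT claimed here.
[cite: Balaban1988Convergent, (2.7) p.255, (2.21) p.258, (2.28) p.259, (3.16)–(3.22) pp.268–269; Balaban1987RG1, (1.12)–(1.15) p.262 (hypothesis dictionary; bookkeeping)] -/
theorem exists_isDatumOfRecord₁₃CCoPHN_iff_exists_params :
    (∃ D : FiniteEpsData F (SU N), IsDatumOfRecord₁₃CCoPHN F N D) ↔
      ∃ θ : Stage13HParams F N, θ.Provisos₁₃CoPH F N ∧ (θ.ZhUnity F N ∧ θ.SlotsNondegenerate₁₃ F N) ∧ θ.Admissible F N :=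
  exists_isDatumOfRecord₁₃CCoPHOn_iff_exists_params F N _

/-- … and iff some CN record exists. [cite: Balaban1989LargeFieldII, Thm 1 + (0.1) pp.355–356 (bookkeeping)] -/
theorem exists_isRecordOfRecord₁₃CCoPHN_iff_exists_params :
    (∃ (D : FiniteEpsData F (SU N)) (w : WorldP), IsRecordOfRecord₁₃CCoPHN F N D w) ↔
      ∃ θ : Stage13HParams F N, θ.Provisos₁₃CoPH F N ∧ (θ.ZhUnity F N ∧ θ.SlotsNondegenerate₁₃ F N) ∧ θ.Admissible F N :=
  (exists_isDatumOfRecord₁₃CCoPHOn_iff_exists_record F N _).symm.trans (exists_isDatumOfRecord₁₃CCoPHN_iff_exists_params F N)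

/-- **THE K2′ ∕ K3′ JUNCTION**: a world-blind property at EVERY CN record ⟺ the θ-keyed sentence «`∀ θ (h : θ.Provisos₁₃CoPH F N), (θ.ZhUnity F N ∧ θ.SlotsNondegenerate₁₃ F N) →
θ.Admissible F N → P (datumOfRecord₁₃CoPH F N θ h)`» — the items' binder prefix (what a `Spine` ∕ endpoint composer over the CN record class reads the text off).
[cite: Balaban1989LargeFieldII, Thm 1 + (0.1) pp.355–356 (bookkeeping)] -/
theorem forall_isRecordOfRecord₁₃CCoPHN_iff (P : FiniteEpsData F (SU N) → Prop) :
    (∀ (D : FiniteEpsData F (SU N)) (w : WorldP), IsRecordOfRecord₁₃CCoPHN F N D w → P D) ↔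
      ∀ (θ : Stage13HParams F N) (h : θ.Provisos₁₃CoPH F N), (θ.ZhUnity F N ∧ θ.SlotsNondegenerate₁₃ F N) → θ.Admissible F N → P (datumOfRecord₁₃CoPH F N θ h) :=
  forall_isRecordOfRecord₁₃CCoPHOn_iff F N _ P

/-- … datum-level form. [cite: Balaban1989LargeFieldII, Thm 1 + (0.1) pp.355–356 (bookkeeping)] -/
theorem forall_isDatumOfRecord₁₃CCoPHN_iff (P : FiniteEpsData F (SU N) → Prop) :
    (∀ D : FiniteEpsData F (SU N), IsDatumOfRecord₁₃CCoPHN F N D → P D) ↔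
      ∀ (θ : Stage13HParams F N) (h : θ.Provisos₁₃CoPH F N), (θ.ZhUnity F N ∧ θ.SlotsNondegenerate₁₃ F N) → θ.Admissible F N → P (datumOfRecord₁₃CoPH F N θ h) :=
  forall_isDatumOfRecord₁₃CCoPHOn_iff F N _ P

/-- Every guarded admissible θ with provisos is a CN record at some world with any window `0 < γw ≤ θ.γ`. [cite: Balaban1989LargeFieldII, Thm 1 + (0.1) pp.355–356 (bookkeeping)] -/
theorem exists_world_isRecordOfRecord₁₃CCoPHN (θ : Stage13HParams F N) (h : θ.Provisos₁₃CoPH F N) (hG : θ.ZhUnity F N ∧ θ.SlotsNondegenerate₁₃ F N) (hθ : θ.Admissible F N)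
    {γw : ℝ} (hγw : 0 < γw ∧ γw ≤ θ.γ) : ∃ w : WorldP, IsRecordOfRecord₁₃CCoPHN F N (datumOfRecord₁₃CoPH F N θ h) w ∧ w.γ = γw :=
  exists_world_isRecordOfRecord₁₃CCoPHOn F N _ θ h hG hθ hγw

variable {F N}
variable {D : FiniteEpsData F (SU N)} {w : WorldP}

/-- **THE GUARD AT THE CANONICAL CN PARAMETER** — the one thing the C key cannot supply. [cite: Balaban1988Convergent, (3.16)–(3.22) pp.268–269 (bookkeeping)] -/
theorem IsDatumOfRecord₁₃CCoPHN.guard (h : IsDatumOfRecord₁₃CCoPHN F N D) : h.params.ZhUnity F N ∧ h.params.SlotsNondegenerate₁₃ F N :=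
  h.regime

/-- Print's partition of unity at the canonical CN parameter. [cite: Balaban1988Convergent, (3.16)–(3.20) pp.268–269 (bookkeeping)] -/
theorem IsDatumOfRecord₁₃CCoPHN.zhUnity (h : IsDatumOfRecord₁₃CCoPHN F N D) : h.params.ZhUnity F N :=
  h.regime.1

/-- Non-degeneracy of the present slots at the canonical CN parameter. [cite: Balaban1988Convergent, (3.22) p.269 (bookkeeping)] -/
theorem IsDatumOfRecord₁₃CCoPHN.slotsNondegenerate (h : IsDatumOfRecord₁₃CCoPHN F N D) : h.params.SlotsNondegenerate₁₃ F N :=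
  h.regime.2

/-- **WHAT A CONSUMER PROVES UNDER THE GUARD ⟹ WHAT THE CN INSTANCE CARRIES** (the items' binder order: guard, then admissibility). [cite: Balaban1989LargeFieldII, Thm 1 p.355 (bookkeeping)] -/
theorem IsDatumOfRecord₁₃CCoPHN.forall_params {P : (D : FiniteEpsData F (SU N)) → (θ : Stage13HParams F N) → θ.Provisos₁₃CoPH F N → Prop}
    (hP : ∀ (θ : Stage13HParams F N) (hθ : θ.Provisos₁₃CoPH F N), (θ.ZhUnity F N ∧ θ.SlotsNondegenerate₁₃ F N) → θ.Admissible F N → P (datumOfRecord₁₃CoPH F N θ hθ) θ hθ)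
    (h : IsDatumOfRecord₁₃CCoPHN F N D) : P D h.params h.provisos :=
  IsDatumOfRecord₁₃CCoPHOn.forall_params hP h

/-- A CN datum is a C datum (the guard forgotten; its C-canonical parameter is NOT asserted to satisfy the guard). [cite: Balaban1989LargeFieldII, Thm 1 p.355 (bookkeeping)] -/
theorem IsDatumOfRecord₁₃CCoPHN.isDatumOfRecord₁₃CCoPH (h : IsDatumOfRecord₁₃CCoPHN F N D) : IsDatumOfRecord₁₃CCoPH F N D :=
  h.toC

/-- A CN record is a Stage-13 record. [cite: Balaban1989LargeFieldII, Thm 1 p.355 (bookkeeping)] -/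
theorem IsRecordOfRecord₁₃CCoPHN.isRecordOfRecord₁₃CCoPH' (h : IsRecordOfRecord₁₃CCoPHN F N D w) : IsRecordOfRecord₁₃CCoPH F N D w :=
  h.isRecordOfRecord₁₃CCoPH

/-- The guarded tuple behind a CN record (feeds the ₁₃ re-key of `s_R00x_rRec₁₂On_of_regime 𝔯 ·` at `unityNondeg₁₃H N` in one application). [cite: Balaban1989LargeFieldII, Thm 1 + (0.1) pp.355–356 (bookkeeping)] -/
theorem IsRecordOfRecord₁₃CCoPHN.exists_guarded_tuple (h : IsRecordOfRecord₁₃CCoPHN F N D w) :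
    ∃ (θ : Stage13HParams F N) (hP : θ.Provisos₁₃CoPH F N), (θ.ZhUnity F N ∧ θ.SlotsNondegenerate₁₃ F N) ∧ θ.Admissible F N ∧ D = datumOfRecord₁₃CoPH F N θ hP :=
  h.exists_regime_tuple

/-- A datum of record whose C-canonical parameter satisfies the guard is a CN datum. [cite: Balaban1989LargeFieldII, Thm 1 p.355 (bookkeeping)] -/
theorem IsDatumOfRecord₁₃CCoPH.isDatumOfRecord₁₃CCoPHN_of_guard (h : IsDatumOfRecord₁₃CCoPH F N D) (hG : h.params.ZhUnity F N ∧ h.params.SlotsNondegenerate₁₃ F N) :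
    IsDatumOfRecord₁₃CCoPHN F N D :=
  h.isDatumOfRecord₁₃CCoPHOn_of_regime_params hG

end Guard

/-! ## §8. THE HISTORY-BLIND DOORS `…CoPR → …CoPH` along def-T's `Stage13HParams.ofHistoryBlind` (ONE-WAY; the datum-level half of «K0 (v1.7) ⇐ K0 (v1.6)»)

Every v1.6 `CoPR`-keyed class instance IS a v1.7 `CoPH`-keyed one AT THE SAME DATUM (and world), the parameter being def-T's history-blind embedding
`Stage13HParams.ofHistoryBlind F N θ := ⟨θ, fun p _ _ _ => θ.Zr p⟩` (`Node00/Record13CoPH`: `Stage13RParams.Provisos₁₃CoPR.ofHistoryBlind`, `datumOfRecord₁₃CoPH_ofHistoryBlind`, `Stage13HParams.toStage5₁₃CoPH_ofHistoryBlind`,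
`Stage13RParams.ZrUnity.ofHistoryBlind`; admissibility and slot non-degeneracy are read through `toStage13Params` and pass definitionally).
NO CONVERSE: a history-indexed residual need not be history-blind (FINDING №9) — nothing `CoPH → CoPR` is statable as an implication of classes and none is filed; the v1.5 → v1.6
run-blind doors of `Node00/Record13DatumKeyCoPR` §8 compose with these (v1.5 → v1.7) and are not re-issued. -/

section HistoryBlindDoors

variable {F : T4Family} {N : ℕ} [NeZero N]
variable {D : FiniteEpsData F (SU N)} {w : WorldP}

/-- **EVERY v1.6 DATUM OF RECORD IS A v1.7 DATUM OF RECORD** (same datum; parameter `Stage13HParams.ofHistoryBlind F N h.params`).  One-way.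
[cite: Balaban1989LargeFieldII, Thm 1 + (0.1) pp.355–356; Balaban1988Convergent, (3.16) p.268, (3.23) p.270 (bookkeeping)] -/
theorem IsDatumOfRecord₁₃CCoPH.ofCoPR (h : IsDatumOfRecord₁₃CCoPR F N D) : IsDatumOfRecord₁₃CCoPH F N D := by
  obtain ⟨θ, hP, hθ, hD⟩ := h
  exact ⟨Stage13HParams.ofHistoryBlind F N θ, hP.ofHistoryBlind, hθ, hD.trans (datumOfRecord₁₃CoPH_ofHistoryBlind hP).symm⟩

/-- **EVERY v1.6 KEYED RECORD IS A v1.7 KEYED RECORD at the history-blind embedding of its parameter** (same datum, same world; the Stage-5 view by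
`Stage13HParams.toStage5₁₃CoPH_ofHistoryBlind`).  One-way. [cite: Balaban1989LargeFieldII, Thm 1 + (0.1) pp.355–356 (bookkeeping)] -/
theorem IsRateKey₁₃CoPH.ofCoPR {θ : Stage13RParams F N} (hk : IsRateKey₁₃CoPR F N D w θ) : IsRateKey₁₃CoPH F N D w (Stage13HParams.ofHistoryBlind F N θ) := by
  obtain ⟨hP, hθ, hD, hC, hγ, hL, hup⟩ := hk
  exact ⟨hP.ofHistoryBlind, hθ, hD.trans (datumOfRecord₁₃CoPH_ofHistoryBlind hP).symm, hC, hγ, hL,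
    fun P => (hup P).trans (congrArg (fun ϑ => upOfRecord₅C F N ϑ P) (Stage13HParams.toStage5₁₃CoPH_ofHistoryBlind F N θ).symm)⟩

/-- **REGIME FORM, DATUM**: a v1.6 datum of record IN a regime `Rg` is a v1.7 datum of record in any regime `RgH` the history-blind embedding carries `Rg` into.  One-way.
[cite: Balaban1989LargeFieldII, Thm 1 + (0.1) pp.355–356 (bookkeeping)] -/
theorem IsDatumOfRecord₁₃CCoPHOn.ofCoPR {Rg : (F : T4Family) → Stage13RParams F N → Prop} {RgH : (F : T4Family) → Stage13HParams F N → Prop}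
    (hRg : ∀ (F : T4Family) (θ : Stage13RParams F N), Rg F θ → RgH F (Stage13HParams.ofHistoryBlind F N θ)) (h : IsDatumOfRecord₁₃CCoPROn F N Rg D) :
    IsDatumOfRecord₁₃CCoPHOn F N RgH D := by
  obtain ⟨θ, hP, hr, hθ, hD⟩ := h
  exact ⟨Stage13HParams.ofHistoryBlind F N θ, hP.ofHistoryBlind, hRg F θ hr, hθ, hD.trans (datumOfRecord₁₃CoPH_ofHistoryBlind hP).symm⟩

/-- **REGIME FORM, RECORD**: a v1.6 record IN a regime `Rg` is a v1.7 record in any regime `RgH` the history-blind embedding carries `Rg` into.  One-way.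
[cite: Balaban1989LargeFieldII, Thm 1 + (0.1) pp.355–356 (bookkeeping)] -/
theorem IsRecordOfRecord₁₃CCoPHOn.ofCoPR {Rg : (F : T4Family) → Stage13RParams F N → Prop} {RgH : (F : T4Family) → Stage13HParams F N → Prop}
    (hRg : ∀ (F : T4Family) (θ : Stage13RParams F N), Rg F θ → RgH F (Stage13HParams.ofHistoryBlind F N θ)) (h : IsRecordOfRecord₁₃CCoPROn F N Rg D w) :
    IsRecordOfRecord₁₃CCoPHOn F N RgH D w := by
  obtain ⟨θ, hr, hk⟩ := h
  exact ⟨Stage13HParams.ofHistoryBlind F N θ, hRg F θ hr, IsRateKey₁₃CoPH.ofCoPR hk⟩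

/-- **CN FORM, DATUM**: a v1.6 CN datum of record (guard `unityNondeg₁₃R N`: `ZrUnity ∧ SlotsNondegenerate₁₃`) is a v1.7 CN datum of record (guard `unityNondeg₁₃H N`), the
partition of unity transported by def-T's `Stage13RParams.ZrUnity.ofHistoryBlind`, slot non-degeneracy definitionally.  One-way.
[cite: Balaban1988Convergent, (3.16)–(3.22) pp.268–269; Balaban1989LargeFieldII, Thm 1 p.355 (bookkeeping)] -/
theorem IsDatumOfRecord₁₃CCoPHN.ofCoPR (h : IsDatumOfRecord₁₃CCoPRN F N D) : IsDatumOfRecord₁₃CCoPHN F N D :=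
  IsDatumOfRecord₁₃CCoPHOn.ofCoPR (fun _ _ hG => ⟨hG.1.ofHistoryBlind, hG.2⟩) h

/-- **CN FORM, RECORD**: a v1.6 CN record is a v1.7 CN record (same datum, same world).  One-way.
[cite: Balaban1988Convergent, (3.16)–(3.22) pp.268–269; Balaban1989LargeFieldII, Thm 1 p.355 (bookkeeping)] -/
theorem IsRecordOfRecord₁₃CCoPHN.ofCoPR (h : IsRecordOfRecord₁₃CCoPRN F N D w) : IsRecordOfRecord₁₃CCoPHN F N D w :=
  IsRecordOfRecord₁₃CCoPHOn.ofCoPR (fun _ _ hG => ⟨hG.1.ofHistoryBlind, hG.2⟩) h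

end HistoryBlindDoors

end Literature.MathematicalPhysics.QuantumFieldTheory.Balaban1983to89.Node00

end
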